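import Literature.Probability.LatticeModels.HighDimTriviality
import Literature.Probability.LatticeModels.GKSInequalities
import Literature.Probability.LatticeModels.GibbsStates
import Literature.Probability.LatticeModels.Sharpness
import Mathlib.MeasureTheory.Integral.DominatedConvergence
import Mathlib.Analysis.SpecialFunctions.Exponential

/-!
# High-dimensional triviality of Ising scaling limits, II: moment-level estimates and their summation

Trunk: StatMech (G02); family `crit-ising` (crit-ising.S13). Namespace `Literature.CritIsing`.
Second layer under `HighDimTriviality` (the printed exponential-moment estimates
`aizenmanDuminilCopin_mgf_normalizedField_bound` (ADC 2021, Prop. 1.4, `d = 4`),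
`panis_mgf_normalizedField_bound` (Panis 2023, Thm 5.5, `d ≥ 5`), the variance bounds, and the
Gaussianity of scaling limits in the printed regime derived from them).

Sources (numbering of the held arXiv versions):

* M. Aizenman, H. Duminil-Copin, *Marginal triviality of the scaling limits of critical 4D Ising
  and `φ⁴₄` models*, Ann. of Math. 194 (2021) 163–235 = arXiv:1912.07973 ("ADC"), §6.3
  "Proof of Proposition 1.4", p. 26: its first display (Aizenman 1982, deviation of the
  `2n`-point function from Wick's law, `0 ≤ 𝒢_n[S] - S_{2n} ≤ -(3/2) ∑ S_{2n-4} U₄`), the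
  moment bound obtained by smearing it (second display), the summation over `n`
  ("Multiplying by `z^{2n}/(2n)!` and summing"), and the bound
  `S(L, r, β) ≤ C₂ r¹² (log log L / log L)^c` (Thm 1.3 + infrared bounds).
* R. Panis, *Triviality of the scaling limits of critical Ising and `φ⁴` models with effective
  dimension at least four*, arXiv:2309.05797 ("Panis"), Prop. 4.6 (deviation from Wick's law),
  proof of Thm 5.5 (pp. 21–22: the same two displays, with `⟨T_{|f|,L,β}^{2n-4}⟩` and the
  prefactor `exp(z²/2 ⟨T_{|f|,L,β}²⟩)`, and the bound on `S(β, L, f)` for `d_eff > 4`),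
  Cor. 1.8 (the `d = 4` estimate in the same form).

## Contents

* Part A (definitions and named facts, D-0014).
  `ursellFourSum μ L r = Σ_L⁻² ∑_{x ∈ Λ_{rL}⁴} |U₄^μ(x)|` (Panis's `S(β, L, f)`); the
  moment-level printed inputs: `aizenman_evenMoment_deviation_le` (the smeared Aizenman
  inequality of ADC §6.3 /
  Panis Prop. 4.6), `newman_evenMoment_le` (Gaussian domination of even moments, `f ≥ 0`),
  `aizenmanDuminilCopin_ursellFourSum_le` (`d = 4`, critical window: `≤ C r¹² (log L)^{-c}`),
  `panis_ursellFourSum_le` (`d ≥ 5`: `≤ C (β⁻⁴ ∨ β⁻²) r^γ L^{-(d-4)}`),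
  `oddSpinCorrelation_eq_zero` (flip symmetry of the unique state, `β ≤ β_c`); and
  `aizenmanDuminilCopin_mgf_normalizedField_bound_abs`, ADC Prop. 1.4 **in the form its proof
  establishes** (prefactor `exp(z²/2 ⟨T_{|f|,L}²⟩)`; see its docstring for the relation to the
  printed statement, recorded verbatim as `aizenmanDuminilCopin_mgf_normalizedField_bound`).
* Part B. Moments of the normalised field as smeared correlation functions
  (`integral_normalizedField_pow`); odd moments vanish under `oddSpinCorrelation_eq_zero`.
* Part C. The summation step as a theorem of pure probability
  (`abs_mgf_sub_exp_le_of_moment_bounds`): for a bounded `X` with vanishing odd moments,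
  `|E X^{2n} - (2n-1)!! (E X²)ⁿ| ≤ (2n)⁴ E · E Y^{2n-4}` (`n ≥ 2`) and Gaussian domination of
  the even moments of `Y` give `|E e^{zX} - e^{z² E X²/2}| ≤ 16 E z⁴ e^{z² E Y²/2}`
  (`(2n)⁴/(2n)! ≤ 16/(2n-4)!`; exchange of sum and integral by dominated convergence).
* Part D. **Proved reductions**: the four moment-level facts imply
  `aizenmanDuminilCopin_mgf_normalizedField_bound_abs` (`…_of_moments`, constant `24 C`) and
  `panis_mgf_normalizedField_bound` of `HighDimTriviality` (`…_of_moments`).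
* Part E. The Gaussianity of scaling limits in the printed regime,
  `isGaussianProcess_of_tendstoInDistribution_smearedSpin_printRegime`, from
  `aizenmanDuminilCopin_mgf_normalizedField_bound_abs`, `normalizedField_variance_bounds` and
  `panis_mgf_normalizedField_bound` (`…_of_bounds'`; the argument of `HighDimTriviality`,
  Part II, with the `d = 4` prefactor handled as for `d ≥ 5`).
* Part F. `oddSpinCorrelation_eq_zero` **proved** from the structure of `𝒢(β, 0)`: uniqueness
  up to `β_c` (crit-ising.S25/S09 named facts), the free state `exists_freeMeasure` (named fact)
  and the finite-volume symmetry `isingCorr_free_of_odd_card` of `IsingModel`, through the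
  proved thermodynamic limit `hasBoxLimit_isingCorr_free_holds` of `GKSInequalities`.
* Part G. `normalizedField_variance_bounds` of `HighDimTriviality` **proved** from the same
  structural facts (`…_of_facts`): every `μ ∈ 𝒢(β,0)`, `β ≤ β_c`, is the translation-invariant
  free state with non-negative two-point function (`freeCorr_nonneg`, proved GKS); then
  `⟨S_a²⟩ ≤ ⟨S_b²⟩` for `|a| ≤ b` (Griffiths monotonicity of second moments), a covering of
  `B(m')` by `(2k+1)^d` translates of `B(m)`, Cauchy–Schwarz and translation invariance give the
  doubling inequality `Σ_{m'} ≤ (2k+1)^{2d} Σ_m` (`integral_sq_sum_box_le`), whence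
  `⟨T_{f,L}²⟩ ≤ ‖f‖_∞² (2⌈r⌉+3)^{2d}` and, for `f ≥ 0` with `f ≥ η` near a point,
  `⟨T_{f,L}²⟩ ≥ η² (2⌈2/δ₀⌉+3)^{-2d}` for `L ≥ 1/δ₀ + 1`.
* Part H. The capstone `…_printRegime_of_facts`: crit-ising.S13 (printed regime) from the eight
  remaining named facts (two random-current moment inequalities, two `∑ |U₄|` bounds, uniqueness
  below and at `β_c`, existence of the free state, finite-volume flip symmetry), of which the
  flip symmetry `isingCorr_free_of_odd_card` is discharged in the tree
  (`isingCorr_free_of_odd_card_holds`, `PlusFreeComparison`; not imported here), so that seven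
  inputs are genuinely unproved; the two moment inequalities are in turn reduced to Aizenman's
  inequality for correlation functions (printed form and finite-volume form) in
  `HighDimTrivialityWick`.

## Design choices

* The moment-level facts are stated, like the facts of `HighDimTriviality`, for every DLR state
  `μ ∈ 𝒢(β, 0)` with `0 ≤ β ≤ β_c` (a singleton), test functions continuous and vanishing
  outside a cube `[-r, r]^d` with `r ≥ 1`, `‖f‖_∞ = ⨆ |f|`; dimension thresholds follow the
  sources (`d ≥ 2` for Panis Prop. 4.6; `d ≥ 3` for flip symmetry up to and including `β_c`,
  where uniqueness at `β_c` is the tree's `hasUniqueGibbsMeasure_criticalBeta`).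
* `(2n)!/(2ⁿ n!) = (2n-1)!!` is written as a real quotient; `2n - 4` is `ℕ`-subtraction under
  the hypothesis `2 ≤ n`.
* The `d = 4` bound on `∑ |U₄|` is recorded for `1 < L` (as Prop. 1.4, "every `L ≤ ξ(β)`",
  with `log L > 0`); see the docstring of `aizenmanDuminilCopin_ursellFourSum_le`.

## Mathlib

Used: `MeasureTheory.hasSum_integral_of_summable_integral_norm` (series ↔ integral),
`NormedSpace.expSeries_div_hasSum_exp` with `Real.exp_eq_exp_ℝ`, `Function.Injective.hasSum_iff`
(even/odd reindexing), `hasSum_nat_add_iff'`, `hasSum_le`, `Finset.prod_univ_sum` (multinomial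
expansion of `(∑_x a_x σ_x)^m`). Mathlib has no Ising model / Ursell functions / Wick pairings.
-/

noncomputable section

open MeasureTheory ProbabilityTheory Filter Topology TopologicalSpace
open scoped NNReal Nat
open Literature.Probability.LatticeModels Literature.Probability.Percolation

namespace Literature.Probability.LatticeModels

variable {d : ℕ}

/-! ### Part A. The sum of the four-point Ursell function and the moment-level named facts -/

/-- The normalised sum of the absolute four-point Ursell function over a box,
`S(μ; L, r) = Σ_L(μ)⁻² ∑_{x₁,…,x₄ ∈ Λ_{rL}} |U₄^μ(x₁, x₂, x₃, x₄)|`, where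
`U₄^μ(x₁,…,x₄) = ⟨σ₁σ₂σ₃σ₄⟩ - ⟨σ₁σ₂⟩⟨σ₃σ₄⟩ - ⟨σ₁σ₃⟩⟨σ₂σ₄⟩ - ⟨σ₁σ₄⟩⟨σ₂σ₃⟩` is the
connected four-point function of the (even) state `μ` (`connectedFour` of `Correlations`) and
`Σ_L(μ) = ⟨(∑_{x ∈ Λ_L} σ_x)²⟩_μ` (`blockSpinVariance`). This is Panis's `S(β, L, f)`
(with `Λ_{r_f L}`, `r_f` the support radius of `f`), the quantity through which the deviation
of the smeared field from Gaussianity is controlled (Panis 2023, proof of Thm 5.5, p. 21,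
display defining `S(β,L,f)`; Aizenman–Duminil-Copin 2021, §6.3, p. 26, where the analogous
`S(L,r,β)` already incorporates the tree diagram bound). Junk `·/0 = 0` if `Σ_L(μ) = 0`. [cite: Panis2023Triviality, proof of Thm. 5.5 (p. 21), definition of S(β,L,f)] -/
def ursellFourSum (μ : Measure (SpinConfig (Site d))) (L r : ℝ) : ℝ :=
  (∑ x ∈ Fintype.piFinset fun _ : Fin 4 => latticeBox d (r * L), |connectedFour μ spinAt x|) /
    blockSpinVariance μ L ^ 2

/-- `S(μ; L, r) ≥ 0`. [folklore] -/
theorem ursellFourSum_nonneg (μ : Measure (SpinConfig (Site d))) (L r : ℝ) :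
    0 ≤ ursellFourSum μ L r :=
  div_nonneg (Finset.sum_nonneg fun _ _ => abs_nonneg _) (sq_nonneg _)

/-- **Deviation of the even moments of the smeared field from Wick's law** (Aizenman 1982, via
Aizenman–Duminil-Copin 2021, §6.3, p. 26: the first display (the inequality of [Aiz82]) and
the display following it;
Panis 2023, Prop. 4.6 "Deviation from Wick's law" (`d ≥ 2`, `n ≥ 2`; there the remainder is
written with the pairing sum of the remaining `2n-4` points, which smears to
`(2n-5)!! ⟨T_{|f|,L}²⟩^{n-2}`) and the first display of the proof of Thm 5.5, p. 21, which has
the `⟨T_{|f|,L,β}^{2n-4}⟩` form recorded here). For the nearest-neighbour ferromagnetic Ising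
model on `ℤ^d`, `d ≥ 2`, every `0 ≤ β ≤ β_c`, every DLR state `μ ∈ 𝒢(β, 0)` (a singleton),
`L > 0`, and every `f ∈ C_0(ℝ^d)` vanishing outside `[-r, r]^d` (`r ≥ 1`), for all `n ≥ 2`,
`|⟨T_{f,L}^{2n}⟩ - (2n)!/(2ⁿ n!) ⟨T_{f,L}²⟩ⁿ| ≤ (3/2) (2n)⁴ ⟨T_{|f|,L}^{2n-4}⟩ ‖f‖_∞⁴ S(μ; L, r)`.
This is the pointwise inequality
`|S_{2n}(x₁,…,x_{2n}) - ∑_{pairings π} ∏ ⟨σ_{x_{π(2j-1)}}σ_{x_{π(2j)}}⟩| ≤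
  (3/2) ∑_{i<j<k<l} |U₄(x_i,x_j,x_k,x_l)| · (2n-4)-point term`
(ADC §6.3, first display: `0 ≤ 𝒢_n[S] - S_{2n} ≤ -(3/2) ∑ S_{2n-4} U₄`) multiplied by
`∏ f(x_i/L) / Σ_L^{n}`
and summed over `x ∈ (ℤ^d)^{2n}`: for signed `f` the right-hand side involves the moments of
`T_{|f|,L}` (Panis writes `⟨T_{|f|,L,β}^{2n-4}⟩`; ADC write `⟨T_{f,L}^{2n-4}⟩`, which is the
same for the non-negative `f` to which their Prop. 1.4 is applied). Here
`T_{f,L} = normalizedField μ L f` and `S(μ; L, r) = ursellFourSum μ L r`.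
Named fact (D-0014). [cite: AizenmanDuminilCopinAnnals2021, arXiv:1912.07973 §6.3, first two displays (p. 26)] [cite: Panis2023Triviality, Prop. 4.6 and proof of Thm. 5.5, first display (p. 21)] -/
def aizenman_evenMoment_deviation_le : Prop :=
  ∀ {d : ℕ}, 2 ≤ d → ∀ (β L r : ℝ), 0 ≤ β → β ≤ criticalBeta d → 0 < L → 1 ≤ r →
    ∀ μ ∈ isingGibbsMeasures d β 0,
    ∀ f : EuclideanSpace ℝ (Fin d) → ℝ, Continuous f → (∀ x, f x ≠ 0 → ∀ i, |x i| ≤ r) →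
    ∀ n : ℕ, 2 ≤ n →
      |(∫ σ, normalizedField μ L f σ ^ (2 * n) ∂μ) -
          ((2 * n)! : ℝ) / (2 ^ n * n !) * (∫ σ, normalizedField μ L f σ ^ 2 ∂μ) ^ n|
        ≤ 3 / 2 * (2 * n : ℝ) ^ 4 *
            (∫ σ, normalizedField μ L (fun x => |f x|) σ ^ (2 * n - 4) ∂μ) *
            (⨆ x, |f x|) ^ 4 * ursellFourSum μ L r

/-- **Gaussian domination of the even moments** (the lower inequality `0 ≤ 𝒢_n[S] - S_{2n}`
of the first display of Aizenman–Duminil-Copin 2021, §6.3, p. 26, i.e.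
`S_{2n} ≤ ∑_{pairings} ∏ S₂`; Newman's
Gaussian inequality, Z. Wahrscheinlichkeitstheorie 33 (1975), and Aizenman 1982), multiplied by
`∏ f(x_i/L) ≥ 0` and summed: for the nearest-neighbour ferromagnetic Ising model on `ℤ^d`,
`d ≥ 2`, `0 ≤ β ≤ β_c`, `μ ∈ 𝒢(β, 0)`, `L > 0` and every **non-negative** `f ∈ C_0(ℝ^d)`,
`⟨T_{f,L}^{2n}⟩ ≤ (2n)!/(2ⁿ n!) ⟨T_{f,L}²⟩ⁿ` for all `n`, i.e. the even moments are dominated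
by those of the centred Gaussian with the same variance (whence
`⟨exp(z T_{f,L})⟩ ≤ exp(z²⟨T_{f,L}²⟩/2)`, the prefactor in the third display of ADC §6.3 and in
Panis Thm 5.5). Named fact (D-0014). [cite: AizenmanDuminilCopinAnnals2021, arXiv:1912.07973 §6.3, first display, lower inequality (p. 26)] -/
def newman_evenMoment_le : Prop :=
  ∀ {d : ℕ}, 2 ≤ d → ∀ (β L : ℝ), 0 ≤ β → β ≤ criticalBeta d → 0 < L →
    ∀ μ ∈ isingGibbsMeasures d β 0,
    ∀ f : EuclideanSpace ℝ (Fin d) → ℝ, Continuous f → HasCompactSupport f → (∀ x, 0 ≤ f x) →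
    ∀ n : ℕ,
      ∫ σ, normalizedField μ L f σ ^ (2 * n) ∂μ ≤
        ((2 * n)! : ℝ) / (2 ^ n * n !) * (∫ σ, normalizedField μ L f σ ^ 2 ∂μ) ^ n

/-- **The sum of `|U₄|` over a box in the critical window, `d = 4`** (Aizenman–Duminil-Copin
2021: the improved tree diagram bound, Thm 1.3, applied termwise, and the bound
`S(L, r, β) ≤ C₂ r¹² (log log L / log L)^c` of §6.3, p. 26, which together are the input of
Prop. 1.4). There exist `c, C > 0` such that for the nearest-neighbour ferromagnetic Ising model
on `ℤ⁴`, every `β ≤ β_c`, every `1 < L ≤ ξ(β)` (at `β_c`, every `L > 1`), `r ≥ 1` and the DLR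
state `μ ∈ 𝒢(β, 0)`,
`∑_{x₁,…,x₄ ∈ Λ_{rL}} |U₄^β(x₁,…,x₄)| ≤ C r¹² (log L)^{-c} Σ_L(β)²`.
As for Prop. 1.4 (stated for every `L ≤ ξ(β)`), the printed argument addresses `L` large; for
`L` in a bounded range the left-hand side is at most `C r¹² L⁴` by the plain tree diagram bound
and the infrared bound, which the constant absorbs. The window `L ≤ ξ(β)` is written, as in
`aizenmanDuminilCopin_mgf_normalizedField_bound`, as `L · ξ(β)⁻¹ ≤ 1` with
`ξ⁻¹ = invCorrLength (twoPointPlus 4 β)` for `0 < β`, or `β = β_c`.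
Named fact (D-0014). [cite: AizenmanDuminilCopinAnnals2021, arXiv:1912.07973 Thm 1.3 (p. 6) and §6.3, bound on S(L,r,β) (p. 26)] -/
def aizenmanDuminilCopin_ursellFourSum_le : Prop :=
  ∃ c C : ℝ, 0 < c ∧ 0 < C ∧
    ∀ (β L r : ℝ), 0 ≤ β → β ≤ criticalBeta 4 →
      (β = criticalBeta 4 ∨ (0 < β ∧ L * invCorrLength (twoPointPlus 4 β) ≤ 1)) →
      1 < L → 1 ≤ r →
    ∀ μ ∈ isingGibbsMeasures 4 β 0,
      ursellFourSum μ L r ≤ C * r ^ 12 / Real.log L ^ c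

/-- **The sum of `|U₄|` over a box, `d ≥ 5`** (Panis 2023, proof of Thm 5.5, pp. 21–22: the
tree diagram bound of Aizenman 1982, the sliding-scale infrared bound and the infrared bound
`⟨σ₀σ_x⟩_{β_c} ≤ C/|x|^{d-2}` give `S(β, L, f) ≤ 2[(1) + (2)]` with
`(1) ≤ C₄ β⁻⁴ r_f^{8+d} L^{-(d-4)}` and `(2) ≤ C₉ β⁻² r_f^{8+d} L^{-(d-4)}` (`η = 0`), for the
nearest-neighbour model on `ℤ^d`, `d ≥ 5`, which satisfies (A1)–(A5) and the standing
assumption (5.1) of §5 with `η = 0`). There exist `C, γ > 0` such that for all `0 < β ≤ β_c`,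
`L ≥ 1`, `r ≥ 1` and the DLR state `μ ∈ 𝒢(β, 0)`,
`Σ_L⁻² ∑_{x₁,…,x₄ ∈ Λ_{rL}} |U₄^β(x₁,…,x₄)| ≤ C (β⁻⁴ ∨ β⁻²) r^γ / L^{d-4}`.
Named fact (D-0014). [cite: Panis2023Triviality, proof of Thm. 5.5, bounds on (1) and (2) (pp. 21–22)] -/
def panis_ursellFourSum_le : Prop :=
  ∀ {d : ℕ}, 5 ≤ d → ∃ C γ : ℝ, 0 < C ∧ 0 < γ ∧
    ∀ (β L r : ℝ), 0 < β → β ≤ criticalBeta d → 1 ≤ L → 1 ≤ r →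
    ∀ μ ∈ isingGibbsMeasures d β 0,
      ursellFourSum μ L r ≤ C * max (β ^ (-4 : ℤ)) (β ^ (-2 : ℤ)) * r ^ γ / L ^ (d - 4)

/-- **Odd correlations vanish up to the critical point** ("by flip symmetry
`⟨T_{f,L}^{2n+1}⟩_β = 0`", Aizenman–Duminil-Copin 2021, §6.3, p. 26). For the nearest-neighbour
ferromagnetic Ising model on `ℤ^d`, `d ≥ 3`, and `0 ≤ β ≤ β_c`, every DLR state
`μ ∈ 𝒢(β, 0)` has vanishing odd correlations, `⟨σ_{x₁} ⋯ σ_{x_{2m+1}}⟩_μ = 0`: at zero field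
`𝒢(β, 0)` is a singleton for `β ≤ β_c` (`β < β_c`: crit-ising.S25,
`hasUniqueGibbsMeasure_of_lt_criticalBeta`; `β = β_c`, `d ≥ 3`: Aizenman–Duminil-Copin–Sidoravicius
2015, `hasUniqueGibbsMeasure_criticalBeta`), and the unique state is invariant under the global
spin flip (Friedli–Velenik 2017, Thm. 3.28 with Prop. 3.29: uniqueness iff `m*(β) = 0`, and the
symmetry `⟨σ_A⟩⁻ = (-1)^{|A|} ⟨σ_A⟩⁺`). Named fact (D-0014). [cite: AizenmanDuminilCopinAnnals2021, arXiv:1912.07973 §6.3 (p. 26), "by flip symmetry"] [cite: FriedliVelenik2017, Thm. 3.28 with Prop. 3.29] -/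
def oddSpinCorrelation_eq_zero : Prop :=
  ∀ {d : ℕ}, 3 ≤ d → ∀ β : ℝ, 0 ≤ β → β ≤ criticalBeta d →
    ∀ μ ∈ isingGibbsMeasures d β 0, ∀ {n : ℕ}, Odd n → ∀ x : Fin n → Site d,
      ∫ σ, ∏ i, spinAt (x i) σ ∂μ = 0

/-- **Aizenman–Duminil-Copin 2021, Proposition 1.4, in the form established by its proof**
(§6.3, p. 26, the display `|⟨exp[z T_{f,L}]⟩_β - exp[z²/2 ⟨T_{f,L}²⟩_β]| ≤
exp[z²/2 ⟨T²⟩] C₁ z⁴ ‖f‖_∞⁴ S(L,r,β)` combined with `S(L,r,β) ≤ C₂ r¹² (log log L/log L)^c`;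
this is also the shape of Panis 2023, Cor. 1.8 and Thm 5.5). There exist `c, C > 0` such that
for the nearest-neighbour ferromagnetic Ising model on `ℤ⁴`, every `β ≤ β_c`, every
`1 < L ≤ ξ(β)`, every `f ∈ C_0(ℝ⁴)` vanishing outside `[-r, r]⁴` (`r ≥ 1`), the DLR state
`μ ∈ 𝒢(β, 0)` and all real `z`,
`|⟨exp(z T_{f,L})⟩ - exp(z²/2 ⟨T_{f,L}²⟩)| ≤ exp(z²/2 ⟨T_{|f|,L}²⟩) · C ‖f‖_∞⁴ r¹² z⁴ / (log L)^c`.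

**Relation to the printed Prop. 1.4** (`aizenmanDuminilCopin_mgf_normalizedField_bound`, which
records the statement as printed: no sign condition on `f`, and the bound normalised by
`exp(z²/2 ⟨T_{f,L}²⟩)`). The printed proof smears the inequality of [Aiz82] (§6.3, first
display) against
`∏ᵢ f(xᵢ/L)`; for a signed `f` this bounds the deviation of `⟨T_{f,L}^{2n}⟩` from its Wick value
by the moments `⟨T_{|f|,L}^{2n-4}⟩` (see `aizenman_evenMoment_deviation_le`), so that the
summation over `n` produces the prefactor `exp(z²/2 ⟨T_{|f|,L}²⟩)` — exactly the form in which
Panis restates the estimate (Thm 5.5, Cor. 1.8). For `f ≥ 0` (the case used on p. 6 of ADC to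
deduce Gaussianity) the two forms coincide (`…_abs.of_nonneg` below); for signed `f` the
printed normalisation is stronger than what the argument yields. This form suffices for the
Gaussianity of scaling limits
(`isGaussianProcess_of_tendstoInDistribution_smearedSpin_printRegime_of_bounds'`).
Named fact (D-0014). [cite: AizenmanDuminilCopinAnnals2021, arXiv:1912.07973 Prop. 1.4 (p. 6) and its proof, §6.3 (p. 26)] [cite: Panis2023Triviality, Cor. 1.8 and Thm. 5.5 (form of the estimate)] -/
def aizenmanDuminilCopin_mgf_normalizedField_bound_abs : Prop :=
  ∃ c C : ℝ, 0 < c ∧ 0 < C ∧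
    ∀ (β L r : ℝ), 0 ≤ β → β ≤ criticalBeta 4 →
      (β = criticalBeta 4 ∨ (0 < β ∧ L * invCorrLength (twoPointPlus 4 β) ≤ 1)) →
      1 < L → 1 ≤ r →
    ∀ μ ∈ isingGibbsMeasures 4 β 0,
    ∀ f : EuclideanSpace ℝ (Fin 4) → ℝ, Continuous f → (∀ x, f x ≠ 0 → ∀ i, |x i| ≤ r) →
    ∀ z : ℝ,
      |(∫ σ, Real.exp (z * normalizedField μ L f σ) ∂μ) -
          Real.exp (z ^ 2 / 2 * ∫ σ, normalizedField μ L f σ ^ 2 ∂μ)|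
        ≤ Real.exp (z ^ 2 / 2 * ∫ σ, normalizedField μ L (fun x => |f x|) σ ^ 2 ∂μ) *
            (C * (⨆ x, |f x|) ^ 4 * r ^ 12 * z ^ 4 / Real.log L ^ c)

/-- For non-negative `f`, the form of ADC Prop. 1.4 with the prefactor `exp(z²/2 ⟨T_{|f|,L}²⟩)`
gives back the printed normalised form `|⟨exp[z T - z²/2 ⟨T²⟩]⟩ - 1| ≤ C ‖f‖_∞⁴ r¹² z⁴/(log L)^c`
(Aizenman–Duminil-Copin 2021, Prop. 1.4, p. 6, as used there for `f ≥ 0`). [cite: AizenmanDuminilCopinAnnals2021, arXiv:1912.07973 Prop. 1.4 (p. 6)] -/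
theorem aizenmanDuminilCopin_mgf_normalizedField_bound_abs.of_nonneg
    (h : aizenmanDuminilCopin_mgf_normalizedField_bound_abs) :
    ∃ c C : ℝ, 0 < c ∧ 0 < C ∧
    ∀ (β L r : ℝ), 0 ≤ β → β ≤ criticalBeta 4 →
      (β = criticalBeta 4 ∨ (0 < β ∧ L * invCorrLength (twoPointPlus 4 β) ≤ 1)) →
      1 < L → 1 ≤ r →
    ∀ μ ∈ isingGibbsMeasures 4 β 0,
    ∀ f : EuclideanSpace ℝ (Fin 4) → ℝ, Continuous f → (∀ x, f x ≠ 0 → ∀ i, |x i| ≤ r) →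
      (∀ x, 0 ≤ f x) →
    ∀ z : ℝ,
      |(∫ σ, Real.exp (z * normalizedField μ L f σ -
            z ^ 2 / 2 * ∫ σ', normalizedField μ L f σ' ^ 2 ∂μ) ∂μ) - 1|
        ≤ C * (⨆ x, |f x|) ^ 4 * r ^ 12 * z ^ 4 / Real.log L ^ c := by
  obtain ⟨c, C, hc, hC, H⟩ := h
  refine ⟨c, C, hc, hC, fun β L r hβ hβc hreg hL hr μ hμ f hf hfr hf0 z => ?_⟩
  have habs : normalizedField μ L (fun x => |f x|) = normalizedField μ L f :=
    congrArg (normalizedField μ L) (funext fun x => abs_of_nonneg (hf0 x))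
  have key := H β L r hβ hβc hreg hL hr μ hμ f hf hfr z
  rw [habs] at key
  set V : ℝ := ∫ σ, normalizedField μ L f σ ^ 2 ∂μ with hV
  have hsplit : (∫ σ, Real.exp (z * normalizedField μ L f σ - z ^ 2 / 2 * V) ∂μ) =
      Real.exp (-(z ^ 2 / 2 * V)) * ∫ σ, Real.exp (z * normalizedField μ L f σ) ∂μ := by
    rw [← integral_const_mul (Real.exp (-(z ^ 2 / 2 * V)))]
    refine integral_congr_ae (Eventually.of_forall fun σ => ?_)
    dsimp only
    rw [sub_eq_add_neg, Real.exp_add, mul_comm]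
  rw [hsplit]
  have hpos : 0 < Real.exp (z ^ 2 / 2 * V) := Real.exp_pos _
  have h1 : Real.exp (-(z ^ 2 / 2 * V)) * (∫ σ, Real.exp (z * normalizedField μ L f σ) ∂μ) - 1 =
      Real.exp (-(z ^ 2 / 2 * V)) *
        ((∫ σ, Real.exp (z * normalizedField μ L f σ) ∂μ) - Real.exp (z ^ 2 / 2 * V)) := by
    rw [mul_sub, Real.exp_neg, inv_mul_cancel₀ hpos.ne']
  rw [h1, abs_mul, Real.abs_exp, Real.exp_neg, inv_mul_le_iff₀ hpos]
  exact key

/-! ### Part B. Moments of the normalised field -/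

/-- A function vanishing outside the cube `[-r, r]^d` has compact support. [folklore] -/
theorem hasCompactSupport_of_cube {f : EuclideanSpace ℝ (Fin d) → ℝ} {r : ℝ}
    (hf : ∀ x, f x ≠ 0 → ∀ i, |x i| ≤ r) : HasCompactSupport f := by
  have hK : IsCompact ((EuclideanSpace.equiv (Fin d) ℝ) ⁻¹'
      Set.pi Set.univ fun _ => Set.Icc (-r) r) :=
    (EuclideanSpace.equiv (Fin d) ℝ).toHomeomorph.isCompact_preimage.mpr
      (isCompact_univ_pi fun _ => isCompact_Icc)
  refine HasCompactSupport.intro hK fun x hx => ?_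
  by_contra h
  apply hx
  simp only [Set.mem_preimage, Set.mem_pi, Set.mem_univ, Set.mem_Icc, forall_const]
  intro i
  exact abs_le.mp (hf x h i)

/-- The normalised field as a finite lattice sum: `T_{f,L}(σ) = Σ_L^{-1/2} ∑_{x ∈ Λ} f(x/L) σ_x`
over a box containing the support. [folklore] -/
theorem normalizedField_eq_mul_sum (μ : Measure (SpinConfig (Site d)))
    {f : EuclideanSpace ℝ (Fin d) → ℝ} {r L : ℝ} (hL : L ≠ 0)
    (hf : ∀ x, f x ≠ 0 → ∀ i, |x i| ≤ r) (σ : SpinConfig (Site d)) :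
    normalizedField μ L f σ = (Real.sqrt (blockSpinVariance μ L))⁻¹ *
      ∑ x ∈ latticeBox d (r / |L⁻¹|), f (L⁻¹ • siteVec x) * spinAt x σ := by
  rw [normalizedField, finsum_smear_eq_sum (inv_ne_zero hL) hf]

/-- The normalised field is bounded: `|T_{f,L}(σ)| ≤ Σ_L^{-1/2} ∑_{x ∈ Λ} |f(x/L)|`. [folklore] -/
theorem abs_normalizedField_le (μ : Measure (SpinConfig (Site d)))
    {f : EuclideanSpace ℝ (Fin d) → ℝ} {r L : ℝ} (hL : L ≠ 0)
    (hf : ∀ x, f x ≠ 0 → ∀ i, |x i| ≤ r) (σ : SpinConfig (Site d)) :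
    |normalizedField μ L f σ| ≤ |(Real.sqrt (blockSpinVariance μ L))⁻¹| *
      ∑ x ∈ latticeBox d (r / |L⁻¹|), |f (L⁻¹ • siteVec x)| := by
  rw [normalizedField_eq_mul_sum μ hL hf, abs_mul]
  gcongr
  refine (Finset.abs_sum_le_sum_abs _ _).trans (Finset.sum_le_sum fun x _ => ?_)
  rw [abs_mul, abs_spinAt, mul_one]

/-- Spin monomials are integrable under a finite measure. [folklore] -/
theorem integrable_prod_spinAt (μ : Measure (SpinConfig (Site d))) [IsFiniteMeasure μ] {m : ℕ}
    (p : Fin m → Site d) : Integrable (fun σ => ∏ i, spinAt (p i) σ) μ := by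
  refine Integrable.of_bound
    (Finset.measurable_prod _ fun i _ => measurable_spinAt (p i)).aestronglyMeasurable 1
    (Eventually.of_forall fun σ => ?_)
  rw [Real.norm_eq_abs, Finset.abs_prod]
  simp [abs_spinAt]

/-- **Moments of the smeared field as smeared correlation functions**:
`⟨T_{f,L}^m⟩_μ = Σ_L^{-m/2} ∑_{x₁,…,x_m} ∏ᵢ f(xᵢ/L) ⟨σ_{x₁} ⋯ σ_{x_m}⟩_μ`
(the step from the first to the second display of Aizenman–Duminil-Copin 2021, §6.3, p. 26).
[cite: AizenmanDuminilCopinAnnals2021, arXiv:1912.07973 §6.3 (p. 26)] -/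
theorem integral_normalizedField_pow (μ : Measure (SpinConfig (Site d))) [IsFiniteMeasure μ]
    {f : EuclideanSpace ℝ (Fin d) → ℝ} {r L : ℝ} (hL : L ≠ 0)
    (hf : ∀ x, f x ≠ 0 → ∀ i, |x i| ≤ r) (m : ℕ) :
    ∫ σ, normalizedField μ L f σ ^ m ∂μ =
      (Real.sqrt (blockSpinVariance μ L))⁻¹ ^ m *
        ∑ p ∈ Fintype.piFinset (fun _ : Fin m => latticeBox d (r / |L⁻¹|)),
          (∏ i, f (L⁻¹ • siteVec (p i))) * ∫ σ, ∏ i, spinAt (p i) σ ∂μ := by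
  have hexp : ∀ σ, normalizedField μ L f σ ^ m = (Real.sqrt (blockSpinVariance μ L))⁻¹ ^ m *
      ∑ p ∈ Fintype.piFinset (fun _ : Fin m => latticeBox d (r / |L⁻¹|)),
        (∏ i, f (L⁻¹ • siteVec (p i))) * ∏ i, spinAt (p i) σ := by
    intro σ
    rw [normalizedField_eq_mul_sum μ hL hf σ, mul_pow,
      ← Fin.prod_const m (∑ x ∈ latticeBox d (r / |L⁻¹|), f (L⁻¹ • siteVec x) * spinAt x σ),
      Finset.prod_univ_sum]
    simp_rw [Finset.prod_mul_distrib]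
  simp_rw [hexp]
  rw [integral_const_mul, integral_finsetSum _ fun p _ => (integrable_prod_spinAt μ p).const_mul _]
  simp_rw [integral_const_mul]

/-- Under the vanishing of odd correlations (`oddSpinCorrelation_eq_zero`), the odd moments of
the normalised field vanish: `⟨T_{f,L}^{2m+1}⟩_β = 0` (Aizenman–Duminil-Copin 2021, §6.3, p. 26,
"by flip symmetry"). [cite: AizenmanDuminilCopinAnnals2021, arXiv:1912.07973 §6.3 (p. 26)] -/
theorem integral_normalizedField_pow_eq_zero_of_odd (hodd : oddSpinCorrelation_eq_zero)
    (hd : 3 ≤ d) {β : ℝ} (hβ : 0 ≤ β) (hβc : β ≤ criticalBeta d)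
    {μ : Measure (SpinConfig (Site d))} (hμ : μ ∈ isingGibbsMeasures d β 0)
    {f : EuclideanSpace ℝ (Fin d) → ℝ} {r L : ℝ} (hL : L ≠ 0)
    (hf : ∀ x, f x ≠ 0 → ∀ i, |x i| ≤ r) {m : ℕ} (hm : Odd m) :
    ∫ σ, normalizedField μ L f σ ^ m ∂μ = 0 := by
  haveI : IsProbabilityMeasure μ := hμ.1
  rw [integral_normalizedField_pow μ hL hf m]
  refine mul_eq_zero_of_right _ (Finset.sum_eq_zero fun p _ => ?_)
  rw [hodd hd β hβ hβc μ hμ hm p, mul_zero]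

/-! ### Part C. From moment bounds to exponential moments (the summation of ADC §6.3) -/

/-- The exponential moment of a bounded random variable is the sum of its moment series,
`E[exp(zX)] = ∑_k z^k E[X^k] / k!`. [folklore] -/
theorem hasSum_integral_pow_div_factorial {Ω : Type*} [MeasurableSpace Ω] (μ : Measure Ω)
    [IsFiniteMeasure μ] {X : Ω → ℝ} (hX : Measurable X) {K : ℝ} (hK : ∀ ω, |X ω| ≤ K) (z : ℝ) :
    HasSum (fun k : ℕ => z ^ k / k ! * ∫ ω, X ω ^ k ∂μ) (∫ ω, Real.exp (z * X ω) ∂μ) := by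
  set F : ℕ → Ω → ℝ := fun k ω => (z * X ω) ^ k / k ! with hF
  have hbd : ∀ k ω, ‖F k ω‖ ≤ (|z| * K) ^ k / k ! := fun k ω => by
    rw [hF, Real.norm_eq_abs, abs_div, abs_pow, abs_mul, Nat.abs_cast]
    gcongr
    exact hK ω
  have hFint : ∀ k, Integrable (F k) μ := fun k =>
    Integrable.of_bound (((hX.const_mul z).pow_const k).div_const _).aestronglyMeasurable
      ((|z| * K) ^ k / k !) (Eventually.of_forall (hbd k))
  have hFsum : Summable fun k => ∫ ω, ‖F k ω‖ ∂μ := by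
    refine Summable.of_nonneg_of_le (fun k => integral_nonneg fun ω => norm_nonneg _)
      (fun k => ?_) ((Real.summable_pow_div_factorial (|z| * K)).mul_left (μ.real Set.univ))
    calc ∫ ω, ‖F k ω‖ ∂μ ≤ ∫ _ : Ω, ((|z| * K) ^ k / k ! : ℝ) ∂μ :=
          integral_mono (hFint k).norm (integrable_const _) (hbd k)
      _ = μ.real Set.univ * ((|z| * K) ^ k / k !) := by rw [integral_const, smul_eq_mul]
  have h := hasSum_integral_of_summable_integral_norm hFint hFsum
  have hlim : (fun ω => ∑' k, F k ω) = fun ω => Real.exp (z * X ω) := funext fun ω => by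
    rw [Real.exp_eq_exp_ℝ]
    exact (NormedSpace.expSeries_div_hasSum_exp (z * X ω)).tsum_eq
  rw [hlim] at h
  have heq : (fun k => ∫ a, F k a ∂μ) = fun k => z ^ k / k ! * ∫ ω, X ω ^ k ∂μ := by
    funext k
    rw [hF]
    dsimp only
    rw [← integral_const_mul]
    refine integral_congr_ae (Eventually.of_forall fun ω => ?_)
    dsimp only
    rw [mul_pow]
    ring
  rw [heq] at h
  exact h

/-- The elementary inequality `(2n)⁴/(2n)! ≤ 16/(2n-4)!` for `n ≥ 2`, written with `n = k + 2`.
[folklore] -/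
theorem two_mul_pow_four_div_factorial_le (k : ℕ) :
    (2 * (k + 2 : ℕ) : ℝ) ^ 4 / (2 * (k + 2))! ≤ 16 / (2 * k)! := by
  have hf : ((2 * (k + 2))! : ℝ) =
      (2 * k)! * ((2 * k + 1) * (2 * k + 2) * (2 * k + 3) * (2 * k + 4) : ℝ) := by
    rw [show 2 * (k + 2) = 2 * k + 4 by ring]
    simp only [Nat.factorial_succ]
    push_cast
    ring
  have hk : (0 : ℝ) ≤ k := Nat.cast_nonneg k
  have key : (2 * (k + 2 : ℕ) : ℝ) ^ 4 ≤
      16 * ((2 * k + 1) * (2 * k + 2) * (2 * k + 3) * (2 * k + 4) : ℝ) := by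
    push_cast
    nlinarith [mul_nonneg (mul_nonneg hk hk) hk, mul_nonneg hk hk, hk,
      mul_nonneg (mul_nonneg (mul_nonneg hk hk) hk) hk]
  rw [hf, div_le_div_iff₀ (by positivity) (by positivity)]
  calc (2 * (k + 2 : ℕ) : ℝ) ^ 4 * (2 * k)!
      ≤ 16 * ((2 * k + 1) * (2 * k + 2) * (2 * k + 3) * (2 * k + 4) : ℝ) * (2 * k)! := by
        gcongr
    _ = 16 * ((2 * k)! * ((2 * k + 1) * (2 * k + 2) * (2 * k + 3) * (2 * k + 4) : ℝ)) := by
        ring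

/-- **Summation step of ADC §6.3 / Panis Thm 5.5** (pure probability). Let `X` be a bounded
random variable and `Y` a random variable on a probability space such that (i) the odd moments of `X` vanish, (ii) for
`n ≥ 2`, `|E[X^{2n}] - (2n)!/(2ⁿn!) E[X²]ⁿ| ≤ (2n)⁴ E · E[Y^{2n-4}]`, and (iii) the even moments
of `Y` are dominated by the Gaussian ones, `E[Y^{2n}] ≤ (2n)!/(2ⁿn!) E[Y²]ⁿ`. Then, multiplying
(ii) by `z^{2n}/(2n)!` and summing over `n`,
`|E[exp(zX)] - exp(z² E[X²]/2)| ≤ 16 E z⁴ exp(z² E[Y²]/2)` for every real `z`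
(Aizenman–Duminil-Copin 2021, §6.3, p. 26, "Multiplying [the moment bound] by
`z^{2n}/(2n)!` and summing
over `n`"; Panis 2023, proof of Thm 5.5; the constant: `(2n)⁴/(2n)! ≤ 16/(2n-4)!`). [cite: AizenmanDuminilCopinAnnals2021, arXiv:1912.07973 §6.3 (p. 26)] -/
theorem abs_mgf_sub_exp_le_of_moment_bounds {Ω : Type*} [MeasurableSpace Ω] {μ : Measure Ω}
    [IsProbabilityMeasure μ] {X Y : Ω → ℝ} (hXm : Measurable X)
    {K : ℝ} (hXb : ∀ ω, |X ω| ≤ K) {E : ℝ} (hE : 0 ≤ E)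
    (hdev : ∀ n : ℕ, 2 ≤ n →
      |(∫ ω, X ω ^ (2 * n) ∂μ) - ((2 * n)! : ℝ) / (2 ^ n * n !) * (∫ ω, X ω ^ 2 ∂μ) ^ n|
        ≤ (2 * n : ℝ) ^ 4 * E * ∫ ω, Y ω ^ (2 * n - 4) ∂μ)
    (hdom : ∀ n : ℕ, ∫ ω, Y ω ^ (2 * n) ∂μ ≤
      ((2 * n)! : ℝ) / (2 ^ n * n !) * (∫ ω, Y ω ^ 2 ∂μ) ^ n)
    (hodd : ∀ n : ℕ, ∫ ω, X ω ^ (2 * n + 1) ∂μ = 0) (z : ℝ) :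
    |(∫ ω, Real.exp (z * X ω) ∂μ) - Real.exp (z ^ 2 / 2 * ∫ ω, X ω ^ 2 ∂μ)|
      ≤ 16 * E * z ^ 4 * Real.exp (z ^ 2 / 2 * ∫ ω, Y ω ^ 2 ∂μ) := by
  set V : ℝ := ∫ ω, X ω ^ 2 ∂μ with hV
  set W : ℝ := ∫ ω, Y ω ^ 2 ∂μ with hW
  set m : ℕ → ℝ := fun k => ∫ ω, X ω ^ k ∂μ with hm
  set w : ℕ → ℝ := fun n => ∫ ω, Y ω ^ (2 * n) ∂μ with hw
  have hm2 : m 2 = V := rfl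
  -- even-moment series for the exponential moment of `X`
  have h1 : HasSum (fun k : ℕ => z ^ k / k ! * m k) (∫ ω, Real.exp (z * X ω) ∂μ) :=
    hasSum_integral_pow_div_factorial μ hXm hXb z
  have h2 : HasSum (fun n : ℕ => z ^ (2 * n) / (2 * n)! * m (2 * n))
      (∫ ω, Real.exp (z * X ω) ∂μ) := by
    have key := (Function.Injective.hasSum_iff (mul_right_injective₀ (two_ne_zero' ℕ))
      (f := fun k : ℕ => z ^ k / k ! * m k) (a := ∫ ω, Real.exp (z * X ω) ∂μ) ?_).mpr h1
    · simpa only [Function.comp_def] using key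
    · intro k hk
      rcases Nat.even_or_odd k with ⟨j, hj⟩ | ⟨j, hj⟩
      · exact absurd ⟨j, show 2 * j = k by omega⟩ hk
      · subst hj
        simp only [hm, hodd j, mul_zero]
  -- the Gaussian series `exp(z² V/2) = ∑ z^{2n}/(2n)! · (2n)!/(2ⁿ n!) Vⁿ`
  have hexp2 : ∀ a : ℝ, HasSum (fun n : ℕ => (z ^ 2 / 2 * a) ^ n / n !)
      (Real.exp (z ^ 2 / 2 * a)) := fun a => by
    rw [Real.exp_eq_exp_ℝ]
    exact NormedSpace.expSeries_div_hasSum_exp _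
  have hterm : ∀ (a : ℝ) (n : ℕ), z ^ (2 * n) / (2 * n)! * (((2 * n)! : ℝ) / (2 ^ n * n !) * a ^ n)
      = (z ^ 2 / 2 * a) ^ n / n ! := fun a n => by
    have hn : ((2 * n)! : ℝ) ≠ 0 := by positivity
    rw [pow_mul, show z ^ 2 / 2 * a = z ^ 2 * a / 2 by ring, div_pow, mul_pow]
    field_simp
  have h3 : HasSum (fun n : ℕ => z ^ (2 * n) / (2 * n)! * (((2 * n)! : ℝ) / (2 ^ n * n !) * V ^ n))
      (Real.exp (z ^ 2 / 2 * V)) := by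
    simp_rw [hterm V]
    exact hexp2 V
  -- the difference series
  have h4 : HasSum (fun n : ℕ => z ^ (2 * n) / (2 * n)! *
      (m (2 * n) - ((2 * n)! : ℝ) / (2 ^ n * n !) * V ^ n))
      ((∫ ω, Real.exp (z * X ω) ∂μ) - Real.exp (z ^ 2 / 2 * V)) := by
    have h4' := h2.sub h3
    simp only [← mul_sub] at h4'
    exact h4'
  -- the majorant `c_n = z^{2n}/(2n)! E[Y^{2n}] ≤ (z² W/2)ⁿ/n!`
  have hz2 : ∀ n : ℕ, 0 ≤ z ^ (2 * n) := fun n => by rw [pow_mul]; positivity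
  have hw0 : ∀ n, 0 ≤ w n := fun n => integral_nonneg fun ω => by
    show 0 ≤ Y ω ^ (2 * n)
    rw [pow_mul]; positivity
  have hc_le : ∀ n, z ^ (2 * n) / (2 * n)! * w n ≤ (z ^ 2 / 2 * W) ^ n / n ! := fun n => by
    rw [← hterm W n]
    exact mul_le_mul_of_nonneg_left (hdom n) (div_nonneg (hz2 n) (by positivity))
  have hc_nn : ∀ n, 0 ≤ z ^ (2 * n) / (2 * n)! * w n := fun n =>
    mul_nonneg (div_nonneg (hz2 n) (by positivity)) (hw0 n)
  have hc_sum : Summable fun n => z ^ (2 * n) / (2 * n)! * w n :=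
    Summable.of_nonneg_of_le hc_nn hc_le (hexp2 W).summable
  have hc_tsum : ∑' n, z ^ (2 * n) / (2 * n)! * w n ≤ Real.exp (z ^ 2 / 2 * W) :=
    hasSum_le hc_le hc_sum.hasSum (hexp2 W)
  -- the shifted majorant `b`
  set b : ℕ → ℝ := fun n => if n < 2 then 0 else
    16 * E * z ^ 4 * (z ^ (2 * (n - 2)) / (2 * (n - 2))! * w (n - 2)) with hb_def
  have hb : HasSum b (16 * E * z ^ 4 * ∑' n, z ^ (2 * n) / (2 * n)! * w n) := by
    rw [← hasSum_nat_add_iff' 2]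
    have h0 : ∑ i ∈ Finset.range 2, b i = 0 := by
      simp [hb_def, Finset.sum_range_succ]
    rw [h0, sub_zero]
    have hshift : (fun n => b (n + 2)) = fun n => 16 * E * z ^ 4 * (z ^ (2 * n) / (2 * n)! * w n) := by
      funext n
      simp [hb_def]
    rw [hshift]
    exact hc_sum.hasSum.mul_left _
  -- termwise domination
  have hab : ∀ n, |z ^ (2 * n) / (2 * n)! * (m (2 * n) - ((2 * n)! : ℝ) / (2 ^ n * n !) * V ^ n)|
      ≤ b n := by
    intro n
    rcases lt_or_ge n 2 with hn | hn
    · have h0 : m (2 * n) - ((2 * n)! : ℝ) / (2 ^ n * n !) * V ^ n = 0 := by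
        interval_cases n
        · simp [hm]
        · rw [← hm2]
          norm_num [Nat.factorial]
      have hbn : b n = 0 := by rw [hb_def]; exact if_pos hn
      rw [h0, mul_zero, abs_zero, hbn]
    · obtain ⟨k, rfl⟩ : ∃ k, n = k + 2 := ⟨n - 2, by omega⟩
      have hdevn := hdev (k + 2) hn
      have h2n4 : 2 * (k + 2) - 4 = 2 * k := by omega
      rw [h2n4] at hdevn
      have hfac := two_mul_pow_four_div_factorial_le k
      have hz4 : z ^ (2 * (k + 2)) = z ^ 4 * z ^ (2 * k) := by rw [← pow_add]; ring_nf
      have hbk : b (k + 2) = 16 * E * z ^ 4 * (z ^ (2 * k) / (2 * k)! * w k) := by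
        simp [hb_def]
      rw [hbk, abs_mul, abs_div, Nat.abs_cast, abs_of_nonneg (hz2 (k + 2))]
      calc z ^ (2 * (k + 2)) / (2 * (k + 2))! *
            |m (2 * (k + 2)) - ((2 * (k + 2))! : ℝ) / (2 ^ (k + 2) * (k + 2)!) * V ^ (k + 2)|
          ≤ z ^ (2 * (k + 2)) / (2 * (k + 2))! * ((2 * (k + 2 : ℕ) : ℝ) ^ 4 * E * w k) :=
            mul_le_mul_of_nonneg_left (by exact_mod_cast hdevn)
              (div_nonneg (hz2 _) (by positivity))
        _ = z ^ 4 * ((2 * (k + 2 : ℕ) : ℝ) ^ 4 / (2 * (k + 2))!) * (z ^ (2 * k) * E * w k) := by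
            rw [hz4]; ring
        _ ≤ z ^ 4 * (16 / (2 * k)!) * (z ^ (2 * k) * E * w k) :=
            mul_le_mul_of_nonneg_right
              (mul_le_mul_of_nonneg_left hfac (by positivity))
              (mul_nonneg (mul_nonneg (hz2 k) hE) (hw0 k))
        _ = 16 * E * z ^ 4 * (z ^ (2 * k) / (2 * k)! * w k) := by ring
  -- conclusion: `|D| ≤ B ≤ 16 E z⁴ exp(z² W/2)`
  have hup := hasSum_le (fun n => (le_abs_self _).trans (hab n)) h4 hb
  have hlow := hasSum_le (fun n => (neg_le.mpr ((neg_le_abs _).trans (hab n)) : -b n ≤ _)) hb.neg h4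
  have hB : 16 * E * z ^ 4 * ∑' n, z ^ (2 * n) / (2 * n)! * w n ≤
      16 * E * z ^ 4 * Real.exp (z ^ 2 / 2 * W) :=
    mul_le_mul_of_nonneg_left hc_tsum (by positivity)
  rw [abs_le]
  exact ⟨by linarith, by linarith⟩

/-! ### Part D. ADC Prop. 1.4 (proof form) and Panis Thm 5.5 from the moment-level facts -/

/-- `‖f‖_∞ = ⨆ |f| ≥ 0`. [folklore] -/
theorem iSup_abs_nonneg (f : EuclideanSpace ℝ (Fin d) → ℝ) : 0 ≤ ⨆ x, |f x| :=
  Real.iSup_nonneg fun x => abs_nonneg (f x)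

/-- **One state, one test function.** For `d ≥ 3`, `0 ≤ β ≤ β_c`, `μ ∈ 𝒢(β,0)`, `L > 0` and
`f ∈ C_0` vanishing outside `[-r,r]^d`, the deviation / domination / symmetry facts give
`|⟨exp(z T_{f,L})⟩ - exp(z²/2 ⟨T_{f,L}²⟩)| ≤ exp(z²/2 ⟨T_{|f|,L}²⟩) · 24 ‖f‖_∞⁴ S(μ; L, r) z⁴`
(Aizenman–Duminil-Copin 2021, §6.3, p. 26, the display "(eq:MGF)"; Panis 2023, proof of
Thm 5.5, second display; `24 = 16 · 3/2`). [cite: AizenmanDuminilCopinAnnals2021, arXiv:1912.07973 §6.3 (p. 26)] -/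
theorem abs_mgf_normalizedField_sub_exp_le
    (hM1 : aizenman_evenMoment_deviation_le) (hM2 : newman_evenMoment_le)
    (hodd : oddSpinCorrelation_eq_zero) (hd : 3 ≤ d) {β L r : ℝ} (hβ : 0 ≤ β)
    (hβc : β ≤ criticalBeta d) (hL : 0 < L) (hr : 1 ≤ r)
    {μ : Measure (SpinConfig (Site d))} (hμ : μ ∈ isingGibbsMeasures d β 0)
    {f : EuclideanSpace ℝ (Fin d) → ℝ} (hf : Continuous f)
    (hfr : ∀ x, f x ≠ 0 → ∀ i, |x i| ≤ r) (z : ℝ) :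
    |(∫ σ, Real.exp (z * normalizedField μ L f σ) ∂μ) -
        Real.exp (z ^ 2 / 2 * ∫ σ, normalizedField μ L f σ ^ 2 ∂μ)|
      ≤ Real.exp (z ^ 2 / 2 * ∫ σ, normalizedField μ L (fun x => |f x|) σ ^ 2 ∂μ) *
          (24 * (⨆ x, |f x|) ^ 4 * ursellFourSum μ L r * z ^ 4) := by
  haveI : IsProbabilityMeasure μ := hμ.1
  have hd2 : 2 ≤ d := by omega
  have hLne : L ≠ 0 := hL.ne'
  have hfar : ∀ x, (fun y => |f y|) x ≠ 0 → ∀ i, |x i| ≤ r := fun x hx =>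
    hfr x (abs_ne_zero.mp hx)
  set E : ℝ := 3 / 2 * (⨆ x, |f x|) ^ 4 * ursellFourSum μ L r with hE_def
  have hE : 0 ≤ E :=
    mul_nonneg (mul_nonneg (by norm_num) (pow_nonneg (iSup_abs_nonneg f) 4))
      (ursellFourSum_nonneg μ L r)
  have key := abs_mgf_sub_exp_le_of_moment_bounds (μ := μ) (X := normalizedField μ L f)
    (Y := normalizedField μ L fun x => |f x|) (measurable_normalizedField μ hLne hfr)
    (abs_normalizedField_le μ hLne hfr) hE ?_ ?_ ?_ z
  · calc _ ≤ 16 * E * z ^ 4 *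
          Real.exp (z ^ 2 / 2 * ∫ σ, normalizedField μ L (fun x => |f x|) σ ^ 2 ∂μ) := key
      _ = _ := by rw [hE_def]; ring
  · intro n hn
    calc _ ≤ _ := hM1 hd2 β L r hβ hβc hL hr μ hμ f hf hfr n hn
      _ = _ := by rw [hE_def]; ring
  · intro n
    exact hM2 hd2 β L hβ hβc hL μ hμ _ hf.abs (hasCompactSupport_of_cube hfar)
      (fun x => abs_nonneg _) n
  · intro n
    exact integral_normalizedField_pow_eq_zero_of_odd hodd hd hβ hβc hμ hLne hfr ⟨n, rfl⟩

/-- **ADC Prop. 1.4 (in the form its proof yields) from the moment-level facts**: the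
deviation from Wick's law (`aizenman_evenMoment_deviation_le`), Gaussian domination
(`newman_evenMoment_le`), the `d = 4` bound on `∑ |U₄|` in the critical window
(`aizenmanDuminilCopin_ursellFourSum_le`) and the vanishing of odd correlations
(`oddSpinCorrelation_eq_zero`) imply `aizenmanDuminilCopin_mgf_normalizedField_bound_abs`
(Aizenman–Duminil-Copin 2021, §6.3, proof of Prop. 1.4, p. 26). [cite: AizenmanDuminilCopinAnnals2021, arXiv:1912.07973 §6.3, proof of Prop. 1.4 (p. 26)] -/
theorem aizenmanDuminilCopin_mgf_normalizedField_bound_abs_of_moments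
    (hM1 : aizenman_evenMoment_deviation_le) (hM2 : newman_evenMoment_le)
    (hS : aizenmanDuminilCopin_ursellFourSum_le) (hodd : oddSpinCorrelation_eq_zero) :
    aizenmanDuminilCopin_mgf_normalizedField_bound_abs := by
  obtain ⟨c, C, hc, hC, H⟩ := hS
  refine ⟨c, 24 * C, hc, by positivity, fun β L r hβ hβc hreg hL hr μ hμ f hf hfr z => ?_⟩
  have hSle := H β L r hβ hβc hreg hL hr μ hμ
  have key := abs_mgf_normalizedField_sub_exp_le hM1 hM2 hodd (by norm_num) hβ hβc
    (one_pos.trans hL) hr hμ hf hfr z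
  refine key.trans (mul_le_mul_of_nonneg_left ?_ (Real.exp_pos _).le)
  have h0 : 0 ≤ (⨆ x, |f x|) ^ 4 := pow_nonneg (iSup_abs_nonneg f) 4
  have hz : 0 ≤ z ^ 4 := by positivity
  calc 24 * (⨆ x, |f x|) ^ 4 * ursellFourSum μ L r * z ^ 4
      ≤ 24 * (⨆ x, |f x|) ^ 4 * (C * r ^ 12 / Real.log L ^ c) * z ^ 4 := by gcongr
    _ = 24 * C * (⨆ x, |f x|) ^ 4 * r ^ 12 * z ^ 4 / Real.log L ^ c := by ring

/-- **Panis Thm 5.5 (`d ≥ 5`, nearest-neighbour) from the moment-level facts**: the deviation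
from Wick's law, Gaussian domination, the `d ≥ 5` bound on `∑ |U₄|` (`panis_ursellFourSum_le`)
and the vanishing of odd correlations imply `panis_mgf_normalizedField_bound`
(Panis 2023, proof of Thm 5.5, pp. 21–22). [cite: Panis2023Triviality, proof of Thm. 5.5 (pp. 21–22)] -/
theorem panis_mgf_normalizedField_bound_of_moments
    (hM1 : aizenman_evenMoment_deviation_le) (hM2 : newman_evenMoment_le)
    (hS : panis_ursellFourSum_le) (hodd : oddSpinCorrelation_eq_zero) :
    panis_mgf_normalizedField_bound := by
  intro d hd
  obtain ⟨C, γ, hC, hγ, H⟩ := hS hd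
  refine ⟨24 * C, γ, by positivity, hγ, fun β L r hβ hβc hL hr μ hμ f hf hfr z => ?_⟩
  have hSle := H β L r hβ hβc hL hr μ hμ
  have key := abs_mgf_normalizedField_sub_exp_le hM1 hM2 hodd (by omega) hβ.le hβc
    (one_pos.trans_le hL) hr hμ hf hfr z
  refine key.trans (mul_le_mul_of_nonneg_left ?_ (Real.exp_pos _).le)
  have h0 : 0 ≤ (⨆ x, |f x|) ^ 4 := pow_nonneg (iSup_abs_nonneg f) 4
  have hz : 0 ≤ z ^ 4 := by positivity
  calc 24 * (⨆ x, |f x|) ^ 4 * ursellFourSum μ L r * z ^ 4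
      ≤ 24 * (⨆ x, |f x|) ^ 4 *
          (C * max (β ^ (-4 : ℤ)) (β ^ (-2 : ℤ)) * r ^ γ / L ^ (d - 4)) * z ^ 4 := by gcongr
    _ = 24 * C * max (β ^ (-4 : ℤ)) (β ^ (-2 : ℤ)) * (⨆ x, |f x|) ^ 4 * r ^ γ * z ^ 4 /
          L ^ (d - 4) := by ring

/-! ### Part E. Gaussianity of scaling limits from ADC Prop. 1.4 in proof form -/

/-- **Core estimate (one test function), from ADC Prop. 1.4 in proof form.** In the setting of
`isGaussianProcess_of_tendstoInDistribution_smearedSpin_printRegime`, with `μ_k` plain measures,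
the printed estimates give `M_k(z) exp(-z² E[Φ_k(g)²]/2) - 1 → 0` for the exponential moments
`M_k(z) = E[exp(z Φ_k(g))]`, `z ∈ ℝ`, of the rescaled field tested against a continuous compactly
supported `g`, provided the second moments of `Φ_k(g)` and of `Φ_k(f₀)` for one nonnegative
`f₀ ≢ 0` are bounded (ADC 2021, p. 6; Panis 2023, after Thm 1.2). Printed window: for `d = 4`,
eventually `β_k = β_c` or `L_k = 1/δ_k ≤ ξ(β_k)`; for `d ≥ 5`, eventually `β_k ≥ β₀ > 0`.
Same argument as `tendsto_mgf_mul_exp_sub_one` of `HighDimTriviality`, with the `d = 4`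
prefactor `exp(z²/2 ⟨T_{|g|,L}²⟩)` bounded, as for `d ≥ 5`, through the upper variance bound
applied to `|g|`. [cite: AizenmanDuminilCopinAnnals2021, arXiv:1912.07973 Prop. 1.4 and p. 6] -/
theorem tendsto_mgf_mul_exp_sub_one'
    (h₁ : aizenmanDuminilCopin_mgf_normalizedField_bound_abs)
    (h₂ : normalizedField_variance_bounds)
    (h₃ : panis_mgf_normalizedField_bound)
    (hd : 4 ≤ d) {β δ ρ : ℕ → ℝ} (hβ : ∀ k, β k ∈ Set.Icc 0 (criticalBeta d))
    (hδ : Tendsto δ atTop (𝓝[>] (0 : ℝ)))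
    (h4 : d = 4 → ∀ᶠ k in atTop, β k = criticalBeta 4 ∨
      (0 < β k ∧ invCorrLength (twoPointPlus 4 (β k)) ≤ δ k))
    (h5 : 5 ≤ d → ∃ β₀ : ℝ, 0 < β₀ ∧ ∀ᶠ k in atTop, β₀ ≤ β k)
    {μ : ℕ → Measure (SpinConfig (Site d))}
    (hμ : ∀ k, μ k ∈ isingGibbsMeasures d (β k) 0)
    {g : EuclideanSpace ℝ (Fin d) → ℝ} (hg : Continuous g) (hgs : HasCompactSupport g)
    {Cg : ℝ} (hCg : ∀ k, ∫ σ, smearedSpin (ρ k) (δ k) g σ ^ 2 ∂μ k ≤ Cg)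
    {f₀ : EuclideanSpace ℝ (Fin d) → ℝ} (hf₀ : Continuous f₀) (hf₀s : HasCompactSupport f₀)
    (hf₀0 : ∀ x, 0 ≤ f₀ x) (hf₀ne : f₀ ≠ 0)
    {C₀ : ℝ} (hC₀ : ∀ k, ∫ σ, smearedSpin (ρ k) (δ k) f₀ σ ^ 2 ∂μ k ≤ C₀) (z : ℝ) :
    Tendsto (fun k =>
      (∫ σ, Real.exp (z * smearedSpin (ρ k) (δ k) g σ) ∂μ k) *
          Real.exp (-(z ^ 2 * (∫ σ, smearedSpin (ρ k) (δ k) g σ ^ 2 ∂μ k) / 2)) - 1)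
      atTop (𝓝 0) := by
  -- meshes: `δ_k > 0` eventually and `L_k = 1/δ_k → ∞`
  have hδpos : ∀ᶠ k in atTop, 0 < δ k := hδ.eventually (eventually_mem_nhdsWithin)
  have hLtop : Tendsto (fun k => (δ k)⁻¹) atTop atTop := tendsto_inv_nhdsGT_zero.comp hδ
  obtain ⟨r, hr1, hgr⟩ := exists_cube_of_hasCompactSupport g hgs
  -- variance bounds: upper for `|g|`, lower for the bump `f₀`
  obtain ⟨Cabs, hCabs⟩ := (h₂ hd (fun x => |g x|) hg.abs (hgs.comp_left abs_zero)).1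
  obtain ⟨c₀, L₀, hc₀, hlow⟩ := (h₂ hd f₀ hf₀ hf₀s).2 hf₀0 hf₀ne
  set A2 : ℝ := C₀ / c₀ with hA2
  have hA2nn : 0 ≤ A2 :=
    div_nonneg ((integral_nonneg fun σ => sq_nonneg _).trans (hC₀ 0)) hc₀.le
  have hev : ∀ᶠ k in atTop, 0 < δ k ∧ 1 < (δ k)⁻¹ ∧ L₀ ≤ (δ k)⁻¹ :=
    (hδpos.and (hLtop.eventually (eventually_gt_atTop 1))).and
      (hLtop.eventually (eventually_ge_atTop L₀)) |>.mono fun k hk => ⟨hk.1.1, hk.1.2, hk.2⟩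
  -- per-`k` renormalisation: `Φ_k(f) = a_k T_{f,L_k}` with `a_k² ≤ A2`
  have hren : ∀ k, 0 < δ k → L₀ ≤ (δ k)⁻¹ →
      ∃ a : ℝ, a ^ 2 ≤ A2 ∧ ∀ (f : EuclideanSpace ℝ (Fin d) → ℝ) (σ : SpinConfig (Site d)),
        smearedSpin (ρ k) (δ k) f σ = a * normalizedField (μ k) (δ k)⁻¹ f σ := by
    intro k hδk hLL₀
    have hlowk := hlow (β k) (δ k)⁻¹ (hβ k).1 (hβ k).2 hLL₀ (μ k) (hμ k)
    have hS0 : Real.sqrt (blockSpinVariance (μ k) (δ k)⁻¹) ≠ 0 := by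
      intro hS0
      have h0 : ∀ σ, normalizedField (μ k) (δ k)⁻¹ f₀ σ = 0 := fun σ => by
        rw [normalizedField, hS0, inv_zero, zero_mul]
      have : ∫ σ, normalizedField (μ k) (δ k)⁻¹ f₀ σ ^ 2 ∂μ k = 0 := by simp [h0]
      linarith
    refine ⟨ρ k * δ k ^ d * Real.sqrt (blockSpinVariance (μ k) (δ k)⁻¹), ?_,
      fun f σ => smearedSpin_eq_mul_normalizedField (μ k) hS0 f σ⟩
    set a := ρ k * δ k ^ d * Real.sqrt (blockSpinVariance (μ k) (δ k)⁻¹) with ha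
    have h1 : a ^ 2 * ∫ σ, normalizedField (μ k) (δ k)⁻¹ f₀ σ ^ 2 ∂μ k ≤ C₀ := by
      have h := hC₀ k
      have heq : ∀ σ, smearedSpin (ρ k) (δ k) f₀ σ ^ 2 =
          a ^ 2 * normalizedField (μ k) (δ k)⁻¹ f₀ σ ^ 2 := fun σ => by
        rw [smearedSpin_eq_mul_normalizedField (μ k) hS0 f₀ σ, mul_pow]
      simp_rw [heq, integral_const_mul] at h
      exact h
    rw [hA2, le_div_iff₀ hc₀]
    calc a ^ 2 * c₀ ≤ a ^ 2 * ∫ σ, normalizedField (μ k) (δ k)⁻¹ f₀ σ ^ 2 ∂μ k :=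
        mul_le_mul_of_nonneg_left hlowk (sq_nonneg a)
      _ ≤ C₀ := h1
  -- the two printed regimes
  rcases hd.eq_or_lt with rfl | hlt
  · -- `d = 4`: Aizenman–Duminil-Copin, in the form its proof yields (prefactor
    -- `exp((az)²/2 ⟨T_{|g|}²⟩)`, bounded through the upper variance bound for `|g|`)
    obtain ⟨c, C, hc, hC, H⟩ := h₁
    have hu : Tendsto (fun k => (Real.log (δ k)⁻¹ ^ c)⁻¹) atTop (𝓝 0) :=
      tendsto_inv_atTop_zero.comp
        ((tendsto_rpow_atTop hc).comp (Real.tendsto_log_atTop.comp hLtop))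
    refine squeeze_zero_norm' (a := fun k =>
      (Real.exp (z ^ 2 / 2 * (A2 * Cabs)) *
        (C * (⨆ x, |g x|) ^ 4 * r ^ 12 * (A2 ^ 2 * z ^ 4))) * (Real.log (δ k)⁻¹ ^ c)⁻¹)
      ((hev.and (h4 rfl)).mono fun k hk => ?_) (by simpa using tendsto_const_nhds.mul hu)
    obtain ⟨⟨hδk, hL1, hLL₀⟩, h4k⟩ := hk
    obtain ⟨a, ha2, hX⟩ := hren k hδk hLL₀
    have hreg : β k = criticalBeta 4 ∨
        (0 < β k ∧ (δ k)⁻¹ * invCorrLength (twoPointPlus 4 (β k)) ≤ 1) := by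
      rcases h4k with h | ⟨hpos, hle⟩
      · exact Or.inl h
      · exact Or.inr ⟨hpos, by rwa [inv_mul_le_iff₀ hδk, mul_one]⟩
    have hest := H (β k) (δ k)⁻¹ r (hβ k).1 (hβ k).2 hreg hL1 hr1 (μ k) (hμ k) g hg hgr (a * z)
    have hV : (∫ σ, smearedSpin (ρ k) (δ k) g σ ^ 2 ∂μ k) =
        a ^ 2 * ∫ σ, normalizedField (μ k) (δ k)⁻¹ g σ ^ 2 ∂μ k := by
      have heq : ∀ σ, smearedSpin (ρ k) (δ k) g σ ^ 2 =
          a ^ 2 * normalizedField (μ k) (δ k)⁻¹ g σ ^ 2 := fun σ => by rw [hX g σ, mul_pow]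
      simp_rw [heq, integral_const_mul]
    have hM : (∫ σ, Real.exp (z * smearedSpin (ρ k) (δ k) g σ) ∂μ k) =
        ∫ σ, Real.exp (a * z * normalizedField (μ k) (δ k)⁻¹ g σ) ∂μ k := by
      refine integral_congr_ae (Eventually.of_forall fun σ => ?_)
      dsimp only
      rw [hX g σ]
      ring_nf
    set s : ℝ := (a * z) ^ 2 / 2 * ∫ σ, normalizedField (μ k) (δ k)⁻¹ g σ ^ 2 ∂μ k with hs_def
    have hs : z ^ 2 * (∫ σ, smearedSpin (ρ k) (δ k) g σ ^ 2 ∂μ k) / 2 = s := by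
      rw [hs_def, hV]
      ring
    have hs0 : 0 ≤ s := mul_nonneg (by positivity) (integral_nonneg fun σ => sq_nonneg _)
    have hW : (a * z) ^ 2 / 2 * ∫ σ, normalizedField (μ k) (δ k)⁻¹ (fun x => |g x|) σ ^ 2 ∂μ k
        ≤ z ^ 2 / 2 * (A2 * Cabs) := by
      have hIle := hCabs (β k) (δ k)⁻¹ (hβ k).1 (hβ k).2 hL1.le (μ k) (hμ k)
      have hI0 : 0 ≤ ∫ σ, normalizedField (μ k) (δ k)⁻¹ (fun x => |g x|) σ ^ 2 ∂μ k :=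
        integral_nonneg fun σ => sq_nonneg _
      calc (a * z) ^ 2 / 2 * ∫ σ, normalizedField (μ k) (δ k)⁻¹ (fun x => |g x|) σ ^ 2 ∂μ k
          = z ^ 2 / 2 * (a ^ 2 *
              ∫ σ, normalizedField (μ k) (δ k)⁻¹ (fun x => |g x|) σ ^ 2 ∂μ k) := by ring
        _ ≤ z ^ 2 / 2 * (A2 * Cabs) := by gcongr
    have hlogpos : 0 < Real.log (δ k)⁻¹ ^ c := Real.rpow_pos_of_pos (Real.log_pos hL1) c
    have hkey : ∀ M : ℝ, |M * Real.exp (-s) - 1| ≤ |M - Real.exp s| := by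
      intro M
      have h1 : M * Real.exp (-s) - 1 = Real.exp (-s) * (M - Real.exp s) := by
        rw [mul_sub, Real.exp_neg, ← mul_comm M, inv_mul_cancel₀ (Real.exp_pos s).ne']
      rw [h1, abs_mul, Real.abs_exp]
      exact mul_le_of_le_one_left (abs_nonneg _) (Real.exp_le_one_iff.mpr (neg_nonpos.mpr hs0))
    rw [Real.norm_eq_abs, hs, hM]
    refine (hkey _).trans ?_
    calc |(∫ σ, Real.exp (a * z * normalizedField (μ k) (δ k)⁻¹ g σ) ∂μ k) - Real.exp s|
        ≤ Real.exp ((a * z) ^ 2 / 2 *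
              ∫ σ, normalizedField (μ k) (δ k)⁻¹ (fun x => |g x|) σ ^ 2 ∂μ k) *
            (C * (⨆ x, |g x|) ^ 4 * r ^ 12 * (a * z) ^ 4 / Real.log (δ k)⁻¹ ^ c) := hest
      _ ≤ Real.exp (z ^ 2 / 2 * (A2 * Cabs)) *
            (C * (⨆ x, |g x|) ^ 4 * r ^ 12 * (A2 ^ 2 * z ^ 4) / Real.log (δ k)⁻¹ ^ c) := by
          have hr0 : 0 < r := one_pos.trans_le hr1
          gcongr
          calc (a * z) ^ 4 = (a ^ 2) ^ 2 * z ^ 4 := by ring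
            _ ≤ A2 ^ 2 * z ^ 4 := by gcongr
      _ = (Real.exp (z ^ 2 / 2 * (A2 * Cabs)) *
            (C * (⨆ x, |g x|) ^ 4 * r ^ 12 * (A2 ^ 2 * z ^ 4))) * (Real.log (δ k)⁻¹ ^ c)⁻¹ := by
          ring
  · -- `d ≥ 5`: Panis (Aizenman, Fröhlich)
    have hd5 : 5 ≤ d := hlt
    obtain ⟨β₀, hβ₀, hβ₀k⟩ := h5 hd5
    obtain ⟨C, γ, hC, hγ, H⟩ := h₃ hd5
    have hu : Tendsto (fun k => ((δ k)⁻¹ ^ (d - 4))⁻¹) atTop (𝓝 0) :=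
      tendsto_inv_atTop_zero.comp ((tendsto_pow_atTop (by omega)).comp hLtop)
    refine squeeze_zero_norm' (a := fun k =>
      (Real.exp (z ^ 2 / 2 * (A2 * Cabs)) * (C * max (β₀ ^ (-4 : ℤ)) (β₀ ^ (-2 : ℤ)) *
        (⨆ x, |g x|) ^ 4 * r ^ γ * (A2 ^ 2 * z ^ 4))) * ((δ k)⁻¹ ^ (d - 4))⁻¹)
      ((hev.and hβ₀k).mono fun k hk => ?_) (by simpa using tendsto_const_nhds.mul hu)
    obtain ⟨⟨hδk, hL1, hLL₀⟩, hβ₀k⟩ := hk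
    obtain ⟨a, ha2, hX⟩ := hren k hδk hLL₀
    have hβk : 0 < β k := hβ₀.trans_le hβ₀k
    have hest := H (β k) (δ k)⁻¹ r hβk (hβ k).2 hL1.le hr1 (μ k) (hμ k) g hg hgr (a * z)
    have hV : (∫ σ, smearedSpin (ρ k) (δ k) g σ ^ 2 ∂μ k) =
        a ^ 2 * ∫ σ, normalizedField (μ k) (δ k)⁻¹ g σ ^ 2 ∂μ k := by
      have heq : ∀ σ, smearedSpin (ρ k) (δ k) g σ ^ 2 =
          a ^ 2 * normalizedField (μ k) (δ k)⁻¹ g σ ^ 2 := fun σ => by rw [hX g σ, mul_pow]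
      simp_rw [heq, integral_const_mul]
    have hM : (∫ σ, Real.exp (z * smearedSpin (ρ k) (δ k) g σ) ∂μ k) =
        ∫ σ, Real.exp (a * z * normalizedField (μ k) (δ k)⁻¹ g σ) ∂μ k := by
      refine integral_congr_ae (Eventually.of_forall fun σ => ?_)
      dsimp only
      rw [hX g σ]
      ring_nf
    set s : ℝ := (a * z) ^ 2 / 2 * ∫ σ, normalizedField (μ k) (δ k)⁻¹ g σ ^ 2 ∂μ k with hs_def
    have hs : z ^ 2 * (∫ σ, smearedSpin (ρ k) (δ k) g σ ^ 2 ∂μ k) / 2 = s := by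
      rw [hs_def, hV]
      ring
    have hs0 : 0 ≤ s := mul_nonneg (by positivity) (integral_nonneg fun σ => sq_nonneg _)
    -- the prefactor `exp((az)²/2 ⟨T_{|g|}²⟩)` is bounded via the upper variance bound
    have hW : (a * z) ^ 2 / 2 * ∫ σ, normalizedField (μ k) (δ k)⁻¹ (fun x => |g x|) σ ^ 2 ∂μ k
        ≤ z ^ 2 / 2 * (A2 * Cabs) := by
      have hIle := hCabs (β k) (δ k)⁻¹ (hβ k).1 (hβ k).2 hL1.le (μ k) (hμ k)
      have hI0 : 0 ≤ ∫ σ, normalizedField (μ k) (δ k)⁻¹ (fun x => |g x|) σ ^ 2 ∂μ k :=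
        integral_nonneg fun σ => sq_nonneg _
      calc (a * z) ^ 2 / 2 * ∫ σ, normalizedField (μ k) (δ k)⁻¹ (fun x => |g x|) σ ^ 2 ∂μ k
          = z ^ 2 / 2 * (a ^ 2 *
              ∫ σ, normalizedField (μ k) (δ k)⁻¹ (fun x => |g x|) σ ^ 2 ∂μ k) := by ring
        _ ≤ z ^ 2 / 2 * (A2 * Cabs) := by gcongr
    have hmax : max (β k ^ (-4 : ℤ)) (β k ^ (-2 : ℤ)) ≤ max (β₀ ^ (-4 : ℤ)) (β₀ ^ (-2 : ℤ)) := by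
      refine max_le_max ?_ ?_ <;>
      · rw [zpow_neg, zpow_neg, zpow_ofNat, zpow_ofNat]
        exact inv_anti₀ (pow_pos hβ₀ _) (pow_le_pow_left₀ hβ₀.le hβ₀k _)
    have hLpos : 0 < (δ k)⁻¹ ^ (d - 4) := pow_pos (inv_pos.mpr hδk) _
    -- `|M e^{-s} - 1| = e^{-s} |M - e^{s}| ≤ |M - e^{s}|`
    have hkey : ∀ M : ℝ, |M * Real.exp (-s) - 1| ≤ |M - Real.exp s| := by
      intro M
      have h1 : M * Real.exp (-s) - 1 = Real.exp (-s) * (M - Real.exp s) := by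
        rw [mul_sub, Real.exp_neg, ← mul_comm M, inv_mul_cancel₀ (Real.exp_pos s).ne']
      rw [h1, abs_mul, Real.abs_exp]
      exact mul_le_of_le_one_left (abs_nonneg _) (Real.exp_le_one_iff.mpr (neg_nonpos.mpr hs0))
    rw [Real.norm_eq_abs, hs, hM]
    refine (hkey _).trans ?_
    calc |(∫ σ, Real.exp (a * z * normalizedField (μ k) (δ k)⁻¹ g σ) ∂μ k) - Real.exp s|
        ≤ Real.exp ((a * z) ^ 2 / 2 *
              ∫ σ, normalizedField (μ k) (δ k)⁻¹ (fun x => |g x|) σ ^ 2 ∂μ k) *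
            (C * max (β k ^ (-4 : ℤ)) (β k ^ (-2 : ℤ)) * (⨆ x, |g x|) ^ 4 * r ^ γ *
              (a * z) ^ 4 / (δ k)⁻¹ ^ (d - 4)) := hest
      _ ≤ Real.exp (z ^ 2 / 2 * (A2 * Cabs)) *
            (C * max (β₀ ^ (-4 : ℤ)) (β₀ ^ (-2 : ℤ)) * (⨆ x, |g x|) ^ 4 * r ^ γ *
              (A2 ^ 2 * z ^ 4) / (δ k)⁻¹ ^ (d - 4)) := by
          have hrγ : 0 ≤ r ^ γ := Real.rpow_nonneg (zero_le_one.trans hr1) γ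
          have hr0 : 0 < r := one_pos.trans_le hr1
          gcongr
          calc (a * z) ^ 4 = (a ^ 2) ^ 2 * z ^ 4 := by ring
            _ ≤ A2 ^ 2 * z ^ 4 := by gcongr
      _ = (Real.exp (z ^ 2 / 2 * (A2 * Cabs)) * (C * max (β₀ ^ (-4 : ℤ)) (β₀ ^ (-2 : ℤ)) *
            (⨆ x, |g x|) ^ 4 * r ^ γ * (A2 ^ 2 * z ^ 4))) * ((δ k)⁻¹ ^ (d - 4))⁻¹ := by
          ring

/-- **Core estimate in the window `L = O(ξ(β))`, from ADC Prop. 1.4 in proof form.** The same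
conclusion as `tendsto_mgf_mul_exp_sub_one'` when, for `d = 4`, the printed condition `L_k ≤ ξ(β_k)` is
relaxed to `L_k ≤ M ξ(β_k)` (`ξ(β_k)⁻¹ ≤ M δ_k`) for a fixed `M ≥ 1`: by dilation covariance
(`smearedSpin_dilate`) the field tested against `g` at mesh `δ_k` is the field tested against
`g(·/M)` at mesh `M δ_k`, i.e. at scale `L_k / M ≤ ξ(β_k)`, where ADC Prop. 1.4 applies.
[cite: AizenmanDuminilCopinAnnals2021, arXiv:1912.07973 Prop. 1.4 and p. 6] -/
theorem tendsto_mgf_mul_exp_sub_one_of_window'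
    (h₁ : aizenmanDuminilCopin_mgf_normalizedField_bound_abs)
    (h₂ : normalizedField_variance_bounds)
    (h₃ : panis_mgf_normalizedField_bound)
    (hd : 4 ≤ d) {β δ ρ : ℕ → ℝ} (hβ : ∀ k, β k ∈ Set.Icc 0 (criticalBeta d))
    (hδ : Tendsto δ atTop (𝓝[>] (0 : ℝ))) {M : ℝ} (hM : 1 ≤ M)
    (h4 : d = 4 → ∀ᶠ k in atTop, β k = criticalBeta 4 ∨
      (0 < β k ∧ invCorrLength (twoPointPlus 4 (β k)) ≤ M * δ k))
    (h5 : 5 ≤ d → ∃ β₀ : ℝ, 0 < β₀ ∧ ∀ᶠ k in atTop, β₀ ≤ β k)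
    {μ : ℕ → Measure (SpinConfig (Site d))}
    (hμ : ∀ k, μ k ∈ isingGibbsMeasures d (β k) 0)
    {g : EuclideanSpace ℝ (Fin d) → ℝ} (hg : Continuous g) (hgs : HasCompactSupport g)
    {Cg : ℝ} (hCg : ∀ k, ∫ σ, smearedSpin (ρ k) (δ k) g σ ^ 2 ∂μ k ≤ Cg)
    {f₀ : EuclideanSpace ℝ (Fin d) → ℝ} (hf₀ : Continuous f₀) (hf₀s : HasCompactSupport f₀)
    (hf₀0 : ∀ x, 0 ≤ f₀ x) (hf₀ne : f₀ ≠ 0)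
    {C₀ : ℝ} (hC₀ : ∀ k, ∫ σ, smearedSpin (ρ k) (δ k) f₀ σ ^ 2 ∂μ k ≤ C₀) (z : ℝ) :
    Tendsto (fun k =>
      (∫ σ, Real.exp (z * smearedSpin (ρ k) (δ k) g σ) ∂μ k) *
          Real.exp (-(z ^ 2 * (∫ σ, smearedSpin (ρ k) (δ k) g σ ^ 2 ∂μ k) / 2)) - 1)
      atTop (𝓝 0) := by
  have hM0 : 0 < M := one_pos.trans_le hM
  have hMne : M ≠ 0 := hM0.ne'
  -- dilated data: mesh `M δ_k`, renormalisation `ρ_k / M^d`, test functions `g(·/M)`, `f₀(·/M)`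
  have hδ' : Tendsto (fun k => M * δ k) atTop (𝓝[>] (0 : ℝ)) := by
    rw [tendsto_nhdsWithin_iff] at hδ ⊢
    refine ⟨by simpa using hδ.1.const_mul M, hδ.2.mono fun k hk => ?_⟩
    exact mul_pos hM0 hk
  have hgc : Continuous fun y : EuclideanSpace ℝ (Fin d) => g (M⁻¹ • y) :=
    hg.comp (continuous_const_smul M⁻¹)
  have hgs' : HasCompactSupport fun y : EuclideanSpace ℝ (Fin d) => g (M⁻¹ • y) :=
    hgs.comp_smul (inv_ne_zero hMne)
  have hfc : Continuous fun y : EuclideanSpace ℝ (Fin d) => f₀ (M⁻¹ • y) :=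
    hf₀.comp (continuous_const_smul M⁻¹)
  have hfs' : HasCompactSupport fun y : EuclideanSpace ℝ (Fin d) => f₀ (M⁻¹ • y) :=
    hf₀s.comp_smul (inv_ne_zero hMne)
  have hf0' : ∀ x, 0 ≤ (fun y : EuclideanSpace ℝ (Fin d) => f₀ (M⁻¹ • y)) x := fun x => hf₀0 _
  have hfne' : (fun y : EuclideanSpace ℝ (Fin d) => f₀ (M⁻¹ • y)) ≠ 0 := by
    intro h
    apply hf₀ne
    funext x
    have hx := congr_fun h (M • x)
    simp only [smul_smul, inv_mul_cancel₀ hMne, one_smul, Pi.zero_apply] at hx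
    exact hx
  have hCg' : ∀ k, ∫ σ, smearedSpin (ρ k / M ^ d) (M * δ k) (fun y => g (M⁻¹ • y)) σ ^ 2 ∂μ k
      ≤ Cg := fun k => by
    have h := hCg k
    simp_rw [smearedSpin_dilate hMne g] at h
    exact h
  have hC₀' : ∀ k, ∫ σ, smearedSpin (ρ k / M ^ d) (M * δ k) (fun y => f₀ (M⁻¹ • y)) σ ^ 2 ∂μ k
      ≤ C₀ := fun k => by
    have h := hC₀ k
    simp_rw [smearedSpin_dilate hMne f₀] at h
    exact h
  have key := tendsto_mgf_mul_exp_sub_one' h₁ h₂ h₃ hd hβ hδ' (ρ := fun k => ρ k / M ^ d)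
    h4 h5 hμ hgc hgs' hCg' hfc hfs' hf0' hfne' hC₀' z
  refine key.congr fun k => ?_
  simp_rw [← smearedSpin_dilate hMne g]

/-- **crit-ising.S13, printed regime, from the printed estimates (ADC Prop. 1.4 in the form its
proof yields).** The Gaussianity of scaling limits
`isGaussianProcess_of_tendstoInDistribution_smearedSpin_printRegime` follows from
`aizenmanDuminilCopin_mgf_normalizedField_bound_abs` (`d = 4`), Panis 2023 Thm 5.5 (`d ≥ 5`)
and the variance bounds, through moment generating functions and linearity (the argument printed after ADC
Prop. 1.4 and after Panis Thm 1.2). [cite: AizenmanDuminilCopinAnnals2021, arXiv:1912.07973 Prop. 1.4 and p. 6] -/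
theorem isGaussianProcess_of_tendstoInDistribution_smearedSpin_printRegime_of_bounds'
    (h₁ : aizenmanDuminilCopin_mgf_normalizedField_bound_abs)
    (h₂ : normalizedField_variance_bounds)
    (h₃ : panis_mgf_normalizedField_bound) :
    isGaussianProcess_of_tendstoInDistribution_smearedSpin_printRegime := by
  intro d hd β δ ρ hβ hδ hρ h4 h5 μ hμ Ω _ P _ Φ hM2 hCV
  obtain ⟨f₀, hf₀0, hf₀ne⟩ := exists_testFn_nonneg_ne_zero d
  obtain ⟨C₀, hC₀⟩ := hM2 f₀
  have hδpos : ∀ᶠ k in atTop, 0 < δ k := hδ.eventually (eventually_mem_nhdsWithin)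
  have hprob : ∀ k, IsProbabilityMeasure (μ k : Measure (SpinConfig (Site d))) :=
    fun k => inferInstance
  -- the window constant `M ≥ 1` (only relevant for `d = 4`)
  obtain ⟨M, hM1, h4'⟩ : ∃ M : ℝ, 1 ≤ M ∧ (d = 4 → ∀ᶠ k in atTop, β k = criticalBeta 4 ∨
      (0 < β k ∧ invCorrLength (twoPointPlus 4 (β k)) ≤ M * δ k)) := by
    by_cases hd4 : d = 4
    · obtain ⟨M, hM⟩ := h4 hd4
      refine ⟨max M 1, le_max_right _ _, fun _ => ?_⟩
      filter_upwards [hM, hδpos] with k hk hδk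
      rcases hk with h | ⟨hβk, hle⟩
      · exact Or.inl h
      · exact Or.inr ⟨hβk, hle.trans (mul_le_mul_of_nonneg_right (le_max_left _ _) hδk.le)⟩
    · exact ⟨1, le_rfl, fun h => absurd h hd4⟩
  -- Step A: every one-dimensional marginal `Φ g` is a centred Gaussian
  have h1d : ∀ g : TestFn d, ∃ v : ℝ≥0, P.map (Φ g) = gaussianReal 0 v := by
    intro g
    obtain ⟨Cg, hCg⟩ := hM2 g
    obtain ⟨r, hr1, hgr⟩ := exists_cube_of_hasCompactSupport g g.hasCompactSupport
    have hcv := hCV g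
    have hX : ∀ k, AEMeasurable (fun σ => smearedSpin (ρ k) (δ k) g σ)
        (μ k : Measure (SpinConfig (Site d))) := hcv.forall_aemeasurable
    have hΦg : AEMeasurable (Φ g) P := hcv.aemeasurable_limit
    haveI : IsProbabilityMeasure (P.map (Φ g)) := Measure.isProbabilityMeasure_map hΦg
    -- the exponential moments `M_k(z)`
    have hcore : ∀ z : ℝ, Tendsto (fun k =>
        (∫ σ, Real.exp (z * smearedSpin (ρ k) (δ k) g σ) ∂(μ k : Measure (SpinConfig (Site d)))) *
          Real.exp (-(z ^ 2 * (∫ σ, smearedSpin (ρ k) (δ k) g σ ^ 2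
            ∂(μ k : Measure (SpinConfig (Site d)))) / 2)) - 1) atTop (𝓝 0) := fun z =>
      tendsto_mgf_mul_exp_sub_one_of_window' h₁ h₂ h₃ hd hβ hδ hM1 h4' h5
        (μ := fun k => (μ k : Measure (SpinConfig (Site d)))) hμ g.continuous
        g.hasCompactSupport hCg f₀.continuous f₀.hasCompactSupport hf₀0 hf₀ne hC₀ z
    -- uniform bound on `M_k(z)`: eventually `M_k(z) ≤ 2 exp(z² Cg/2)`
    have hbound : ∀ z : ℝ, ∀ᶠ k in atTop,
        (∫ σ, Real.exp (z * smearedSpin (ρ k) (δ k) g σ) ∂(μ k : Measure (SpinConfig (Site d))))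
          ≤ 2 * Real.exp (z ^ 2 * Cg / 2) := by
      intro z
      have h := (hcore z)
      have h2 : ∀ᶠ k in atTop, (∫ σ, Real.exp (z * smearedSpin (ρ k) (δ k) g σ)
          ∂(μ k : Measure (SpinConfig (Site d)))) *
            Real.exp (-(z ^ 2 * (∫ σ, smearedSpin (ρ k) (δ k) g σ ^ 2
              ∂(μ k : Measure (SpinConfig (Site d)))) / 2)) - 1 < 1 :=
        h.eventually (gt_mem_nhds one_pos)
      filter_upwards [h2] with k hk
      set V := ∫ σ, smearedSpin (ρ k) (δ k) g σ ^ 2 ∂(μ k : Measure (SpinConfig (Site d)))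
      have hVle : V ≤ Cg := hCg k
      have hlt : (∫ σ, Real.exp (z * smearedSpin (ρ k) (δ k) g σ)
          ∂(μ k : Measure (SpinConfig (Site d)))) * Real.exp (-(z ^ 2 * V / 2)) < 2 := by
        linarith
      rw [Real.exp_neg, ← div_eq_mul_inv, div_lt_iff₀ (Real.exp_pos _)] at hlt
      refine hlt.le.trans ?_
      gcongr
    -- laws and weak convergence
    let ν : ℕ → ProbabilityMeasure ℝ := fun k =>
      ⟨(μ k : Measure (SpinConfig (Site d))).map (fun σ => smearedSpin (ρ k) (δ k) g σ),
        Measure.isProbabilityMeasure_map (hX k)⟩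
    let ν₀ : ProbabilityMeasure ℝ := ⟨P.map (Φ g), Measure.isProbabilityMeasure_map hΦg⟩
    have hν : Tendsto ν atTop (𝓝 ν₀) := hcv.tendsto
    -- convergence of `M_k(z)` to the (finite) exponential moment of the limit
    have hlimit : ∀ z : ℝ, Integrable (fun x => Real.exp (z * x)) (P.map (Φ g)) ∧
        Tendsto (fun k => ∫ σ, Real.exp (z * smearedSpin (ρ k) (δ k) g σ)
          ∂(μ k : Measure (SpinConfig (Site d)))) atTop
          (𝓝 (∫ x, Real.exp (z * x) ∂(P.map (Φ g)))) := by
      intro z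
      have hsq : ∀ x : ℝ, Real.exp (z * x) ^ 2 = Real.exp (2 * z * x) := fun x => by
        rw [sq, ← Real.exp_add]
        ring_nf
      have hB : ∀ᶠ k in atTop, Integrable (fun x => Real.exp (z * x) ^ 2) (ν k : Measure ℝ) ∧
          ∫ x, Real.exp (z * x) ^ 2 ∂(ν k : Measure ℝ) ≤ 2 * Real.exp ((2 * z) ^ 2 * Cg / 2) := by
        filter_upwards [hbound (2 * z), hδpos] with k hk hδk
        have hmap : ∀ (F : ℝ → ℝ), Continuous F →
            ∫ x, F x ∂(ν k : Measure ℝ) = ∫ σ, F (smearedSpin (ρ k) (δ k) g σ)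
              ∂(μ k : Measure (SpinConfig (Site d))) := fun F hF => by
          simp only [ν, ProbabilityMeasure.coe_mk]
          exact integral_map (hX k) hF.aestronglyMeasurable
        simp_rw [hsq]
        refine ⟨?_, ?_⟩
        · simp only [ν, ProbabilityMeasure.coe_mk]
          refine (integrable_map_measure (by fun_prop) (hX k)).mpr ?_
          exact integrable_exp_mul_smearedSpin _ (ρ k) hδk.ne' hgr (2 * z)
        · rw [hmap _ (by fun_prop)]
          exact hk
      have h := tendsto_integral_of_tendsto_of_sq_le hν (by fun_prop)
        (fun x => (Real.exp_pos _).le) hB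
      have hmap0 : ∀ k, ∫ x, Real.exp (z * x) ∂(ν k : Measure ℝ) =
          ∫ σ, Real.exp (z * smearedSpin (ρ k) (δ k) g σ)
            ∂(μ k : Measure (SpinConfig (Site d))) := fun k => by
        simp only [ν, ProbabilityMeasure.coe_mk]
        exact integral_map (hX k) (by fun_prop)
      refine ⟨h.1, ?_⟩
      have h2 := h.2
      simp_rw [hmap0] at h2
      exact h2
    -- identification of the limit
    obtain ⟨v, hv0, hv⟩ := exists_variance_of_tendsto_mgf
      (Mlim := fun z => ∫ x, Real.exp (z * x) ∂(P.map (Φ g)))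
      (Eventually.of_forall fun k => integral_nonneg fun σ => sq_nonneg _)
      hcore (fun z => (hlimit z).2)
    exact ⟨v.toNNReal, eq_gaussianReal_of_mgf_eq hv0 (fun z => (hlimit z).1) hv⟩
  -- Step B: linearity of `Φ` upgrades this to all finite-dimensional marginals
  refine ⟨fun I => ⟨isGaussian_of_map_eq_gaussianReal fun L => ?_⟩⟩
  have hmeas : AEMeasurable (fun ω => I.restrict fun f => Φ f ω) P :=
    aemeasurable_pi_lambda _ fun f => (hCV f).aemeasurable_limit
  rw [AEMeasurable.map_map_of_aemeasurable (by fun_prop) hmeas]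
  classical
  let g : TestFn d := ∑ i : I, (L fun j => if i = j then (1 : ℝ) else 0) • (i : TestFn d)
  have hcomp : ((L : (I → ℝ) → ℝ) ∘ fun ω => I.restrict fun f => Φ f ω) = Φ g := by
    funext ω
    rw [Function.comp_apply, ← ContinuousLinearMap.coe_coe,
      LinearMap.pi_apply_eq_sum_univ (L : (I → ℝ) →ₗ[ℝ] ℝ)]
    simp only [g, map_sum, map_smul, Finset.sum_apply, Pi.smul_apply, smul_eq_mul,
      ContinuousLinearMap.coe_coe, Finset.restrict]
    exact Finset.sum_congr rfl fun i _ => mul_comm _ _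
  obtain ⟨v, hv⟩ := h1d g
  exact ⟨0, v, by rw [hcomp, hv]⟩


/-! ### Part F. Flip symmetry from uniqueness and the free state -/

/-- A spin raised to a power only depends on the parity of the exponent (`σ_x² = 1`). [folklore] -/
theorem spinAt_pow_eq_ite {V : Type*} (a : V) (σ : SpinConfig V) (k : ℕ) :
    spinAt a σ ^ k = if Odd k then spinAt a σ else 1 := by
  rcases Nat.even_or_odd k with ⟨j, rfl⟩ | ⟨j, rfl⟩
  · rw [if_neg (Nat.not_odd_iff_even.mpr ⟨j, rfl⟩), ← two_mul, pow_mul, spinAt_sq, one_pow]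
  · rw [if_pos ⟨j, rfl⟩, pow_succ, pow_mul, spinAt_sq, one_pow, one_mul]

/-- **Spin monomials are set correlations.** For sites `x₁, …, x_n` (repetitions allowed),
`∏ᵢ σ_{xᵢ} = σ_A` where `A` is the set of sites occurring an odd number of times, and `|A| ≡ n`
mod 2; in particular `|A|` is odd when `n` is (`σ_x² = 1`; Friedli–Velenik 2017, §3.6.1,
notation `σ_A`). [cite: FriedliVelenik2017, §3.6.1] -/
theorem exists_prod_spinAt_eq_spinProduct {V : Type*} [DecidableEq V] {n : ℕ} (hn : Odd n)
    (x : Fin n → V) :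
    ∃ A : Finset V, Odd A.card ∧ ∀ σ : SpinConfig V, ∏ i, spinAt (x i) σ = spinProduct A σ := by
  classical
  set S : Finset V := Finset.univ.image x with hS
  set c : V → ℕ := fun b => (Finset.univ.filter fun i : Fin n => x i = b).card with hc
  refine ⟨S.filter fun b => Odd (c b), ?_, fun σ => ?_⟩
  · -- parity of `|A|`: `n = ∑_b c_b ≡ #{b : c_b odd}`
    have hsum : n = ∑ b ∈ S, c b := by
      have h := Finset.card_eq_sum_card_image x (Finset.univ : Finset (Fin n))
      simpa [hS, hc] using h
    have hmod : n % 2 = (S.filter fun b => Odd (c b)).card % 2 := by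
      rw [hsum, Finset.sum_nat_mod]
      congr 1
      have : ∀ b ∈ S, c b % 2 = if Odd (c b) then 1 else 0 := fun b _ => by
        split_ifs with h
        · exact Nat.odd_iff.mp h
        · exact Nat.even_iff.mp (Nat.not_odd_iff_even.mp h)
      rw [Finset.sum_congr rfl this, Finset.sum_boole, Nat.cast_id]
    rw [Nat.odd_iff, ← hmod]
    exact Nat.odd_iff.mp hn
  · rw [spinProduct, Finset.prod_filter,
      Finset.prod_comp (s := (Finset.univ : Finset (Fin n))) (fun b => spinAt b σ) x]
    exact Finset.prod_congr rfl fun b _ => spinAt_pow_eq_ite b σ _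

/-- **Flip symmetry from the structure of `𝒢(β, 0)`.** The vanishing of odd correlations up to
`β_c` (`oddSpinCorrelation_eq_zero`) follows from: uniqueness of the Gibbs measure for
`0 ≤ β < β_c` (crit-ising.S25, `hasUniqueGibbsMeasure_of_lt_criticalBeta`) and at `β_c` for
`d ≥ 3` (crit-ising.S09, `hasUniqueGibbsMeasure_criticalBeta`), the existence of the free state
as a DLR measure with correlations `freeCorr` (crit-ising.S05, `exists_freeMeasure`), and the
finite-volume symmetry `⟨σ_A⟩^∅_{Λ;β,0} = 0` for `|A|` odd (`isingCorr_free_of_odd_card` of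
`IsingModel`), through the (proved) thermodynamic limit `hasBoxLimit_isingCorr_free_holds`
(Friedli–Velenik 2017, §3.7.1 eq. (3.33), Exercise 3.16, Thm. 3.28). [cite: FriedliVelenik2017, §3.7.1 eq. (3.33) and Thm. 3.28] -/
theorem oddSpinCorrelation_eq_zero_of_facts
    (hU₁ : ∀ {d : ℕ} {β : ℝ}, hasUniqueGibbsMeasure_of_lt_criticalBeta (d := d) (β := β))
    (hU₂ : ∀ {d : ℕ}, hasUniqueGibbsMeasure_criticalBeta (d := d))
    (hF : ∀ (d : ℕ) {β : ℝ}, exists_freeMeasure d (β := β) 0)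
    (hodd : ∀ d : ℕ, isingCorr_free_of_odd_card (zdGraph d)) :
    oddSpinCorrelation_eq_zero := by
  intro d hd β hβ hβc μ hμ n hn x
  classical
  obtain ⟨μf, hμf, -, hcorr⟩ := hF d hβ le_rfl
  have huniq : HasUniqueGibbsMeasure (isingSpecification (zdGraph d) β 0) := by
    rcases hβc.lt_or_eq with hlt | heq
    · exact hU₁ (by omega) hβ hlt
    · rw [heq]
      exact hU₂ hd
  have hμeq : μ = μf := huniq.1 hμ hμf
  obtain ⟨A, hA, hprod⟩ := exists_prod_spinAt_eq_spinProduct hn x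
  simp_rw [hprod]
  rw [hμeq, show (∫ σ, spinProduct A σ ∂μf) = spinCorr μf A from rfl, hcorr A]
  -- `freeCorr d β 0 A` is the limit of `⟨σ_A⟩^∅_{B(L);β,0} = 0` (eventually, once `A ⊆ B(L)`)
  have hlim := hasBoxLimit_isingCorr_free_holds (d := d) hβ le_rfl A
  obtain ⟨L₀, hL₀⟩ := exists_forall_subset_box d A
  refine tendsto_nhds_unique hlim (tendsto_const_nhds.congr' ?_)
  filter_upwards [eventually_ge_atTop L₀] with L hL
  exact (hodd d (box d L) β (hL₀ L hL) hA).symm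

/-! ### Part G. The variance bounds from translation invariance and Griffiths' first inequality -/

section Variance

/-- A finite linear combination of spins, `S_{B,a}(σ) = ∑_{x ∈ B} a_x σ_x`. [folklore] -/
def spinSum (B : Finset (Site d)) (a : Site d → ℝ) (σ : SpinConfig (Site d)) : ℝ :=
  ∑ x ∈ B, a x * spinAt x σ

/-- The second moment `⟨S_{B,a}²⟩_μ` of a finite linear combination of spins. [folklore] -/
def sqMoment (μ : Measure (SpinConfig (Site d))) (B : Finset (Site d)) (a : Site d → ℝ) : ℝ :=
  ∫ σ, spinSum B a σ ^ 2 ∂μ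

/-- `S_{B,a}` is measurable. [folklore] -/
theorem measurable_spinSum (B : Finset (Site d)) (a : Site d → ℝ) :
    Measurable (spinSum B a) :=
  measurable_sum_mul_spinAt B a

/-- `|S_{B,a}(σ)| ≤ ∑_{x ∈ B} |a_x|`. [folklore] -/
theorem abs_spinSum_le (B : Finset (Site d)) (a : Site d → ℝ) (σ : SpinConfig (Site d)) :
    |spinSum B a σ| ≤ ∑ x ∈ B, |a x| := by
  refine (Finset.abs_sum_le_sum_abs _ _).trans (Finset.sum_le_sum fun x _ => ?_)
  rw [abs_mul, abs_spinAt, mul_one]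

/-- Products of spin sums are integrable under a finite measure. [folklore] -/
theorem integrable_spinSum_mul_spinSum (μ : Measure (SpinConfig (Site d))) [IsFiniteMeasure μ]
    (B B' : Finset (Site d)) (a a' : Site d → ℝ) :
    Integrable (fun σ => spinSum B a σ * spinSum B' a' σ) μ := by
  refine Integrable.of_bound
    ((measurable_spinSum B a).mul (measurable_spinSum B' a')).aestronglyMeasurable
    ((∑ x ∈ B, |a x|) * ∑ x ∈ B', |a' x|) (Eventually.of_forall fun σ => ?_)
  rw [Real.norm_eq_abs, abs_mul]
  exact mul_le_mul (abs_spinSum_le B a σ) (abs_spinSum_le B' a' σ) (abs_nonneg _)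
    (Finset.sum_nonneg fun x _ => abs_nonneg _)

/-- `σ_x σ_y` is integrable under a finite measure. [folklore] -/
theorem integrable_spinAt_mul_spinAt (μ : Measure (SpinConfig (Site d))) [IsFiniteMeasure μ]
    (x y : Site d) : Integrable (fun σ => spinAt x σ * spinAt y σ) μ := by
  refine Integrable.of_bound ((measurable_spinAt x).mul (measurable_spinAt y)).aestronglyMeasurable
    1 (Eventually.of_forall fun σ => ?_)
  rw [Real.norm_eq_abs, abs_mul, abs_spinAt, abs_spinAt, mul_one]

/-- **Expansion of the second moment**:
`⟨S_{B,a}²⟩ = ∑_{x,y ∈ B} a_x a_y ⟨σ_x σ_y⟩` (Aizenman–Duminil-Copin 2021, §1.2,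
`Σ_L = ⟨(∑ σ_x)²⟩`). [folklore] -/
theorem sqMoment_eq_sum (μ : Measure (SpinConfig (Site d))) [IsFiniteMeasure μ]
    (B : Finset (Site d)) (a : Site d → ℝ) :
    sqMoment μ B a = ∑ x ∈ B, ∑ y ∈ B, a x * a y * ∫ σ, spinAt x σ * spinAt y σ ∂μ := by
  have hexp : ∀ σ, spinSum B a σ ^ 2 =
      ∑ x ∈ B, ∑ y ∈ B, a x * a y * (spinAt x σ * spinAt y σ) := fun σ => by
    rw [sq, spinSum, Finset.sum_mul_sum]
    refine Finset.sum_congr rfl fun x _ => Finset.sum_congr rfl fun y _ => ?_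
    ring
  unfold sqMoment
  simp_rw [hexp]
  rw [integral_finsetSum _ fun x _ => integrable_finsetSum _ fun y _ =>
    ((integrable_spinAt_mul_spinAt μ x y).const_mul _)]
  refine Finset.sum_congr rfl fun x _ => ?_
  rw [integral_finsetSum _ fun y _ => (integrable_spinAt_mul_spinAt μ x y).const_mul _]
  refine Finset.sum_congr rfl fun y _ => ?_
  rw [integral_const_mul]

end Variance

section Variance2

/-- **Griffiths monotonicity of second moments**: if `|a_x| ≤ b_x` on `B` and the two-point
function of `μ` is non-negative, then `⟨S_{B,a}²⟩ ≤ ⟨S_{B,b}²⟩`. [folklore] -/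
theorem sqMoment_mono (μ : Measure (SpinConfig (Site d))) [IsFiniteMeasure μ]
    {B : Finset (Site d)} {a b : Site d → ℝ} (hab : ∀ x ∈ B, |a x| ≤ b x)
    (hG : ∀ x y, 0 ≤ ∫ σ, spinAt x σ * spinAt y σ ∂μ) :
    sqMoment μ B a ≤ sqMoment μ B b := by
  rw [sqMoment_eq_sum, sqMoment_eq_sum]
  refine Finset.sum_le_sum fun x hx => Finset.sum_le_sum fun y hy => ?_
  refine mul_le_mul_of_nonneg_right ?_ (hG x y)
  calc a x * a y ≤ |a x * a y| := le_abs_self _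
    _ = |a x| * |a y| := abs_mul _ _
    _ ≤ b x * b y := mul_le_mul (hab x hx) (hab y hy) (abs_nonneg _)
        ((abs_nonneg _).trans (hab x hx))

/-- Enlarging the index set does not change `S_{B,a}` when `a` vanishes on the new sites.
[folklore] -/
theorem spinSum_subset {B B' : Finset (Site d)} (h : B ⊆ B') {a : Site d → ℝ}
    (ha : ∀ x ∈ B', x ∉ B → a x = 0) (σ : SpinConfig (Site d)) :
    spinSum B a σ = spinSum B' a σ :=
  Finset.sum_subset h fun x hx hxB => by rw [ha x hx hxB, zero_mul]

/-- Enlarging the index set does not change `⟨S_{B,a}²⟩` when `a` vanishes on the new sites.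
[folklore] -/
theorem sqMoment_subset (μ : Measure (SpinConfig (Site d))) {B B' : Finset (Site d)}
    (h : B ⊆ B') {a : Site d → ℝ} (ha : ∀ x ∈ B', x ∉ B → a x = 0) :
    sqMoment μ B a = sqMoment μ B' a := by
  unfold sqMoment
  simp_rw [spinSum_subset h ha]

/-- `S_{B, c a} = c S_{B,a}`. [folklore] -/
theorem spinSum_const_mul (B : Finset (Site d)) (c : ℝ) (a : Site d → ℝ)
    (σ : SpinConfig (Site d)) : spinSum B (fun x => c * a x) σ = c * spinSum B a σ := by
  rw [spinSum, spinSum, Finset.mul_sum]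
  exact Finset.sum_congr rfl fun x _ => mul_assoc _ _ _

/-- `⟨S_{B, c a}²⟩ = c² ⟨S_{B,a}²⟩`. [folklore] -/
theorem sqMoment_const_mul (μ : Measure (SpinConfig (Site d))) (B : Finset (Site d)) (c : ℝ)
    (a : Site d → ℝ) : sqMoment μ B (fun x => c * a x) = c ^ 2 * sqMoment μ B a := by
  unfold sqMoment
  simp_rw [spinSum_const_mul, mul_pow]
  exact integral_const_mul _ _

/-- The indicator spin sum is the plain sum of the spins: `S_{B', 1_B} = ∑_{x ∈ B} σ_x` for
`B ⊆ B'`. [folklore] -/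
theorem spinSum_indicator {B B' : Finset (Site d)} (h : B ⊆ B') (σ : SpinConfig (Site d)) :
    spinSum B' (fun x => if x ∈ B then (1 : ℝ) else 0) σ = ∑ x ∈ B, spinAt x σ := by
  rw [← spinSum_subset h (fun x _ hxB => if_neg hxB)]
  refine Finset.sum_congr rfl fun x hx => ?_
  dsimp only
  rw [if_pos hx, one_mul]

/-- The block-spin second moment as a `sqMoment`: `Σ_L(μ) = ⟨S_{B', 1_{Λ_L}}²⟩` for
`Λ_L ⊆ B'`. [folklore] -/
theorem blockSpinVariance_eq_sqMoment (μ : Measure (SpinConfig (Site d))) {L : ℝ}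
    {B' : Finset (Site d)} (h : latticeBox d L ⊆ B') :
    blockSpinVariance μ L = sqMoment μ B' (fun x => if x ∈ latticeBox d L then (1 : ℝ) else 0) := by
  unfold blockSpinVariance sqMoment
  simp_rw [spinSum_indicator h]

/-- **Cauchy–Schwarz over translates**: `⟨(∑_{q ∈ T} F_q)²⟩ ≤ |T| ∑_{q ∈ T} ⟨F_q²⟩` for bounded
measurable `F_q`. [folklore] -/
theorem integral_sq_sum_le {ι : Type*} (μ : Measure (SpinConfig (Site d))) [IsFiniteMeasure μ]
    (T : Finset ι) (B : ι → Finset (Site d)) (a : ι → Site d → ℝ) :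
    ∫ σ, (∑ q ∈ T, spinSum (B q) (a q) σ) ^ 2 ∂μ ≤
      T.card * ∑ q ∈ T, ∫ σ, spinSum (B q) (a q) σ ^ 2 ∂μ := by
  have hpt : ∀ σ, (∑ q ∈ T, spinSum (B q) (a q) σ) ^ 2 ≤
      T.card * ∑ q ∈ T, spinSum (B q) (a q) σ ^ 2 := fun σ => by
    have h := Finset.sum_mul_sq_le_sq_mul_sq T (fun q => spinSum (B q) (a q) σ) fun _ => (1 : ℝ)
    simp only [mul_one, one_pow, Finset.sum_const, nsmul_eq_mul, mul_one] at h
    linarith [h]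
  have hint : ∀ q ∈ T, Integrable (fun σ => spinSum (B q) (a q) σ ^ 2) μ := fun q _ => by
    simp_rw [sq]
    exact integrable_spinSum_mul_spinSum μ _ _ _ _
  calc ∫ σ, (∑ q ∈ T, spinSum (B q) (a q) σ) ^ 2 ∂μ
      ≤ ∫ σ, T.card * ∑ q ∈ T, spinSum (B q) (a q) σ ^ 2 ∂μ := by
        refine integral_mono_of_nonneg (Eventually.of_forall fun σ => sq_nonneg _)
          ((integrable_finsetSum _ hint).const_mul _) (Eventually.of_forall hpt)
    _ = T.card * ∑ q ∈ T, ∫ σ, spinSum (B q) (a q) σ ^ 2 ∂μ := by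
        rw [integral_const_mul, integral_finsetSum _ hint]

/-- **Translation invariance of block-spin moments**: for a translation-invariant `μ`,
`⟨(∑_{x ∈ B + v} σ_x)²⟩_μ = ⟨(∑_{x ∈ B} σ_x)²⟩_μ`. [folklore] -/
theorem integral_sq_sum_spinAt_translate (μ : Measure (SpinConfig (Site d)))
    (hμ : IsTranslationInvariantMeasure μ) (B : Finset (Site d)) (v : Site d) :
    ∫ σ, (∑ x ∈ B.image (· + v), spinAt x σ) ^ 2 ∂μ = ∫ σ, (∑ x ∈ B, spinAt x σ) ^ 2 ∂μ := by
  have hinj : Set.InjOn (· + v) (B : Set (Site d)) := fun x _ y _ h => add_right_cancel h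
  have hpt : ∀ σ, (∑ x ∈ B.image (· + v), spinAt x σ) =
      ∑ x ∈ B, spinAt x (configShift (-v) σ) := fun σ => by
    rw [Finset.sum_image hinj]
    refine Finset.sum_congr rfl fun x _ => ?_
    simp [spinAt, configShift_apply, sub_neg_eq_add]
  simp_rw [hpt]
  have hmeas : Measurable fun σ : SpinConfig (Site d) => (∑ x ∈ B, spinAt x σ) ^ 2 :=
    (Finset.measurable_sum B fun x _ => measurable_spinAt x).pow_const 2
  calc ∫ σ, (∑ x ∈ B, spinAt x (configShift (-v) σ)) ^ 2 ∂μ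
      = ∫ σ, (∑ x ∈ B, spinAt x σ) ^ 2 ∂(μ.map (configShift (-v))) :=
        (integral_map (configShift (-v)).measurable.aemeasurable hmeas.aestronglyMeasurable).symm
    _ = ∫ σ, (∑ x ∈ B, spinAt x σ) ^ 2 ∂μ := by rw [hμ (-v)]

end Variance2

section Covering

/-- Division with remainder: every integer `t` is within `m` of a multiple `(2m+1) q`, with
`|(2m+1) q| ≤ |t| + m`. [folklore] -/
theorem exists_near_multiple (m : ℕ) (t : ℤ) :
    ∃ q : ℤ, |t - (2 * m + 1) * q| ≤ m ∧ |(2 * m + 1 : ℤ) * q| ≤ |t| + m := by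
  have hpos : (0 : ℤ) < 2 * m + 1 := by positivity
  refine ⟨(t + m) / (2 * m + 1), ?_, ?_⟩
  · have h1 := Int.emod_add_mul_ediv (t + m) (2 * m + 1)
    have h2 := Int.emod_nonneg (t + m) hpos.ne'
    have h3 := Int.emod_lt_of_pos (t + m) hpos
    rw [abs_le]
    constructor <;> linarith
  · have h1 := Int.emod_add_mul_ediv (t + m) (2 * m + 1)
    have h2 := Int.emod_nonneg (t + m) hpos.ne'
    have h3 := Int.emod_lt_of_pos (t + m) hpos
    rw [abs_le]
    rcases abs_cases t with ⟨ht, _⟩ | ⟨ht, _⟩ <;> constructor <;> linarith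

/-- **Covering a box by translates of a smaller box**: if `m' + m ≤ k (2m+1)`, every site of
`B(m')` lies in a translate `(2m+1) q + B(m)` with `q ∈ B(k)`. [folklore] -/
theorem exists_translate_of_mem_box {m m' k : ℕ} (hk : m' + m ≤ k * (2 * m + 1)) {x : Site d}
    (hx : x ∈ box d m') :
    ∃ q ∈ box d k, x - ((2 * m + 1 : ℕ) : ℤ) • q ∈ box d m := by
  choose q hq₁ hq₂ using fun i => exists_near_multiple m (x i)
  have hn : (0 : ℤ) < 2 * m + 1 := by positivity
  refine ⟨q, ?_, ?_⟩
  · rw [mem_box]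
    intro i
    have hxi := (mem_box.mp hx) i
    have habs : |x i| ≤ m' := abs_le.mpr ⟨hxi.1, hxi.2⟩
    have h1 : (2 * m + 1 : ℤ) * |q i| ≤ (2 * m + 1 : ℤ) * k := by
      calc (2 * m + 1 : ℤ) * |q i| = |(2 * m + 1 : ℤ) * q i| := by
            rw [abs_mul, abs_of_pos hn]
        _ ≤ |x i| + m := hq₂ i
        _ ≤ m' + m := by linarith
        _ ≤ (2 * m + 1 : ℤ) * k := by rw [mul_comm]; exact_mod_cast hk
    have h2 : |q i| ≤ k := le_of_mul_le_mul_left h1 hn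
    exact abs_le.mp h2
  · rw [mem_box]
    intro i
    have h := hq₁ i
    simp only [Pi.sub_apply, Pi.smul_apply, smul_eq_mul, Nat.cast_add, Nat.cast_mul,
      Nat.cast_ofNat, Nat.cast_one]
    exact abs_le.mp h

variable (d) in
/-- The indicator of the translate `(2m+1) q + B(m)`, as a real coefficient function. [folklore] -/
def translateIndicator (m : ℕ) (q : Site d) (x : Site d) : ℝ :=
  if x ∈ (box d m).image (· + ((2 * m + 1 : ℕ) : ℤ) • q) then 1 else 0

/-- `0 ≤ 1_{(2m+1)q + B(m)} `. [folklore] -/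
theorem translateIndicator_nonneg (m : ℕ) (q x : Site d) : 0 ≤ translateIndicator d m q x := by
  unfold translateIndicator
  split_ifs <;> norm_num

/-- **Indicator domination from the covering**: `1_{B(m')} ≤ ∑_{q ∈ B(k)} 1_{(2m+1)q + B(m)}`
when `m' + m ≤ k(2m+1)`. [folklore] -/
theorem indicator_box_le_sum_translateIndicator {m m' k : ℕ} (hk : m' + m ≤ k * (2 * m + 1))
    (x : Site d) :
    |(if x ∈ box d m' then (1 : ℝ) else 0)| ≤ ∑ q ∈ box d k, translateIndicator d m q x := by
  split_ifs with hx
  · obtain ⟨q, hq, hxq⟩ := exists_translate_of_mem_box hk hx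
    rw [abs_one]
    refine le_trans ?_ (Finset.single_le_sum (fun q' _ => translateIndicator_nonneg m q' x) hq)
    unfold translateIndicator
    rw [if_pos]
    exact Finset.mem_image.mpr ⟨_, hxq, by simp⟩
  · rw [abs_zero]
    exact Finset.sum_nonneg fun q _ => translateIndicator_nonneg m q x

/-- The translates used in the covering lie in the box `B((2m+1)k + m)`. [folklore] -/
theorem image_box_subset_box {m k : ℕ} {q : Site d} (hq : q ∈ box d k) :
    (box d m).image (· + ((2 * m + 1 : ℕ) : ℤ) • q) ⊆ box d ((2 * m + 1) * k + m) := by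
  intro y hy
  obtain ⟨z, hz, rfl⟩ := Finset.mem_image.mp hy
  rw [mem_box] at hz hq ⊢
  intro i
  have hz' := hz i
  have hq' := hq i
  have hqabs : |q i| ≤ k := abs_le.mpr ⟨hq'.1, hq'.2⟩
  have hn : (0 : ℤ) ≤ 2 * m + 1 := by positivity
  have hb : |(2 * m + 1 : ℤ) * q i| ≤ (2 * m + 1) * k := by
    rw [abs_mul, abs_of_nonneg hn]
    exact mul_le_mul_of_nonneg_left hqabs hn
  have hb' := abs_le.mp hb
  simp only [Pi.add_apply, Pi.smul_apply, smul_eq_mul]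
  push_cast
  constructor <;> linarith [hb'.1, hb'.2, hz'.1, hz'.2]

/-- **Doubling inequality for the block-spin second moment.** For a translation-invariant `μ`
with non-negative two-point function and `m' + m ≤ k(2m+1)`,
`⟨(∑_{x ∈ B(m')} σ_x)²⟩ ≤ (2k+1)^{2d} ⟨(∑_{x ∈ B(m)} σ_x)²⟩`: cover `B(m')` by the `(2k+1)^d`
translates `(2m+1)q + B(m)`, use Griffiths monotonicity, Cauchy–Schwarz and translation
invariance (the argument behind "`Σ_{rL} ≤ C_r Σ_L`", implicit in Aizenman–Duminil-Copin 2021,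
p. 6, `C r_f² ‖f‖²_∞ ≥ ⟨T_{f,L}²⟩`). [folklore] -/
theorem integral_sq_sum_box_le (μ : Measure (SpinConfig (Site d))) [IsFiniteMeasure μ]
    (hμ : IsTranslationInvariantMeasure μ) (hG : ∀ x y, 0 ≤ ∫ σ, spinAt x σ * spinAt y σ ∂μ)
    {m m' k : ℕ} (hk : m' + m ≤ k * (2 * m + 1)) :
    ∫ σ, (∑ x ∈ box d m', spinAt x σ) ^ 2 ∂μ ≤
      (((2 * k + 1) ^ d : ℕ) : ℝ) ^ 2 * ∫ σ, (∑ x ∈ box d m, spinAt x σ) ^ 2 ∂μ := by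
  set R : ℕ := (2 * m + 1) * k + m with hR
  have hm'R : box d m' ⊆ box d R := box_mono d (by nlinarith)
  -- Step 1: Griffiths monotonicity against the sum of translate indicators
  have h1 : ∫ σ, (∑ x ∈ box d m', spinAt x σ) ^ 2 ∂μ ≤
      sqMoment μ (box d R) (fun x => ∑ q ∈ box d k, translateIndicator d m q x) := by
    have h0 : ∫ σ, (∑ x ∈ box d m', spinAt x σ) ^ 2 ∂μ =
        sqMoment μ (box d R) (fun x => if x ∈ box d m' then (1 : ℝ) else 0) := by
      unfold sqMoment
      simp_rw [spinSum_indicator hm'R]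
    rw [h0]
    exact sqMoment_mono μ (fun x _ => indicator_box_le_sum_translateIndicator hk x) hG
  -- Step 2: the spin sum of the sum of indicators is the sum of the translated block spins
  have h2 : ∀ σ, spinSum (box d R) (fun x => ∑ q ∈ box d k, translateIndicator d m q x) σ =
      ∑ q ∈ box d k, spinSum (box d R) (translateIndicator d m q) σ := fun σ => by
    simp only [spinSum, Finset.sum_mul]
    rw [Finset.sum_comm]
  have h3 : ∀ q ∈ box d k, ∫ σ, spinSum (box d R) (translateIndicator d m q) σ ^ 2 ∂μ =
      ∫ σ, (∑ x ∈ box d m, spinAt x σ) ^ 2 ∂μ := fun q hq => by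
    have hsub := image_box_subset_box (m := m) hq
    have hpt : ∀ σ, spinSum (box d R) (translateIndicator d m q) σ =
        ∑ x ∈ (box d m).image (· + ((2 * m + 1 : ℕ) : ℤ) • q), spinAt x σ := fun σ =>
      spinSum_indicator hsub σ
    simp_rw [hpt]
    exact integral_sq_sum_spinAt_translate μ hμ (box d m) _
  calc ∫ σ, (∑ x ∈ box d m', spinAt x σ) ^ 2 ∂μ
      ≤ sqMoment μ (box d R) (fun x => ∑ q ∈ box d k, translateIndicator d m q x) := h1
    _ = ∫ σ, (∑ q ∈ box d k, spinSum (box d R) (translateIndicator d m q) σ) ^ 2 ∂μ := by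
        unfold sqMoment
        simp_rw [h2]
    _ ≤ (box d k).card * ∑ q ∈ box d k, ∫ σ, spinSum (box d R) (translateIndicator d m q) σ ^ 2 ∂μ :=
        integral_sq_sum_le μ (box d k) (fun _ => box d R) (translateIndicator d m)
    _ = (box d k).card * ((box d k).card * ∫ σ, (∑ x ∈ box d m, spinAt x σ) ^ 2 ∂μ) := by
        rw [Finset.sum_congr rfl h3, Finset.sum_const, nsmul_eq_mul]
    _ = (((2 * k + 1) ^ d : ℕ) : ℝ) ^ 2 * ∫ σ, (∑ x ∈ box d m, spinAt x σ) ^ 2 ∂μ := by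
        rw [card_box]
        ring

end Covering

section VarianceBounds

/-- Floor arithmetic for the coverings: if `0 ≤ M ≤ t L'`, then
`⌊M⌋ + ⌊L'⌋ ≤ (⌈t⌉ + 1)(2⌊L'⌋ + 1)`. [folklore] -/
theorem floor_add_floor_le_of_le_mul {t M L' : ℝ} (hM₀ : 0 ≤ M) (ht : 0 ≤ t)
    (hM : M ≤ t * L') : ⌊M⌋₊ + ⌊L'⌋₊ ≤ (⌈t⌉₊ + 1) * (2 * ⌊L'⌋₊ + 1) := by
  have h1 : (⌊M⌋₊ : ℝ) ≤ M := Nat.floor_le hM₀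
  have h2 : L' < ⌊L'⌋₊ + 1 := Nat.lt_floor_add_one L'
  have h3 : t ≤ ⌈t⌉₊ := Nat.le_ceil t
  have hm : (0 : ℝ) ≤ ⌊L'⌋₊ := Nat.cast_nonneg _
  have hc : (0 : ℝ) ≤ ⌈t⌉₊ := Nat.cast_nonneg _
  have h4 : t * L' ≤ t * (⌊L'⌋₊ + 1) := mul_le_mul_of_nonneg_left h2.le ht
  have h5 : t * ((⌊L'⌋₊ : ℝ) + 1) ≤ ⌈t⌉₊ * (⌊L'⌋₊ + 1) :=
    mul_le_mul_of_nonneg_right h3 (by linarith)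
  have key : (⌊M⌋₊ : ℝ) + ⌊L'⌋₊ ≤ (⌈t⌉₊ + 1) * (2 * ⌊L'⌋₊ + 1) := by nlinarith
  exact_mod_cast key

/-- `Σ_L(μ) ≥ 1` for a probability measure with non-negative two-point function (`L ≥ 0`):
the diagonal term at the origin. [folklore] -/
theorem one_le_blockSpinVariance (μ : Measure (SpinConfig (Site d))) [IsProbabilityMeasure μ]
    (hG : ∀ x y, 0 ≤ ∫ σ, spinAt x σ * spinAt y σ ∂μ) {L : ℝ} (hL : 0 ≤ L) :
    1 ≤ blockSpinVariance μ L := by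
  set Λ := latticeBox d L with hΛ
  have h0 : (0 : Site d) ∈ Λ := by
    rw [hΛ, mem_latticeBox]
    intro i
    simp [hL]
  rw [blockSpinVariance_eq_sqMoment μ (subset_refl Λ), sqMoment_eq_sum]
  have hterm : ∀ x y : Site d, 0 ≤ (if x ∈ Λ then (1 : ℝ) else 0) * (if y ∈ Λ then (1 : ℝ) else 0) *
      ∫ σ, spinAt x σ * spinAt y σ ∂μ := fun x y =>
    mul_nonneg (mul_nonneg (by split_ifs <;> norm_num) (by split_ifs <;> norm_num)) (hG x y)
  calc (1 : ℝ) = (if (0 : Site d) ∈ Λ then (1 : ℝ) else 0) * (if (0 : Site d) ∈ Λ then (1 : ℝ) else 0) *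
        ∫ σ, spinAt 0 σ * spinAt 0 σ ∂μ := by
        rw [if_pos h0]
        simp
    _ ≤ ∑ y ∈ Λ, (if (0 : Site d) ∈ Λ then (1 : ℝ) else 0) * (if y ∈ Λ then (1 : ℝ) else 0) *
        ∫ σ, spinAt 0 σ * spinAt y σ ∂μ :=
        Finset.single_le_sum (f := fun y => (if (0 : Site d) ∈ Λ then (1 : ℝ) else 0) *
          (if y ∈ Λ then (1 : ℝ) else 0) * ∫ σ, spinAt 0 σ * spinAt y σ ∂μ)
          (fun y _ => hterm 0 y) h0
    _ ≤ ∑ x ∈ Λ, ∑ y ∈ Λ, (if x ∈ Λ then (1 : ℝ) else 0) * (if y ∈ Λ then (1 : ℝ) else 0) *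
        ∫ σ, spinAt x σ * spinAt y σ ∂μ :=
        Finset.single_le_sum (f := fun x => ∑ y ∈ Λ, (if x ∈ Λ then (1 : ℝ) else 0) *
          (if y ∈ Λ then (1 : ℝ) else 0) * ∫ σ, spinAt x σ * spinAt y σ ∂μ)
          (fun x _ => Finset.sum_nonneg fun y _ => hterm x y) h0

/-- The normalised field as a multiple of a `spinSum` over `Λ_{rL}` (`L > 0`). [folklore] -/
theorem normalizedField_eq_mul_spinSum (μ : Measure (SpinConfig (Site d)))
    {f : EuclideanSpace ℝ (Fin d) → ℝ} {r L : ℝ} (hL : 0 < L)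
    (hf : ∀ x, f x ≠ 0 → ∀ i, |x i| ≤ r) (σ : SpinConfig (Site d)) :
    normalizedField μ L f σ = (Real.sqrt (blockSpinVariance μ L))⁻¹ *
      spinSum (latticeBox d (r * L)) (fun x => f (L⁻¹ • siteVec x)) σ := by
  rw [normalizedField_eq_mul_sum μ hL.ne' hf σ, abs_inv, abs_of_pos hL, div_inv_eq_mul]
  rfl

/-- `⟨T_{f,L}²⟩ = Σ_L⁻¹ ⟨S_{Λ_{rL}, f(·/L)}²⟩` (`L > 0`, `Σ_L > 0`). [folklore] -/
theorem integral_normalizedField_sq_eq (μ : Measure (SpinConfig (Site d)))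
    {f : EuclideanSpace ℝ (Fin d) → ℝ} {r L : ℝ} (hL : 0 < L)
    (hf : ∀ x, f x ≠ 0 → ∀ i, |x i| ≤ r) (hS : 0 ≤ blockSpinVariance μ L) :
    ∫ σ, normalizedField μ L f σ ^ 2 ∂μ =
      (blockSpinVariance μ L)⁻¹ * sqMoment μ (latticeBox d (r * L)) (fun x => f (L⁻¹ • siteVec x)) := by
  simp_rw [normalizedField_eq_mul_spinSum μ hL hf, mul_pow]
  rw [integral_const_mul, inv_pow, Real.sq_sqrt hS]
  rfl

/-- **Upper variance bound for one state** (Aizenman–Duminil-Copin 2021, p. 6,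
`⟨T_{f,L}²⟩_β ≤ C r_f² ‖f‖²_∞`; here with the constant `(2⌈r⌉+3)^{2d}` from the covering):
for a translation-invariant probability measure with non-negative two-point function,
`⟨T_{f,L}²⟩ ≤ ‖f‖_∞² (2(⌈r⌉+1)+1)^{2d}` for `L ≥ 1`. [cite: AizenmanDuminilCopinAnnals2021, arXiv:1912.07973 p. 6 (display after Prop. 1.4)] -/
theorem integral_normalizedField_sq_le (μ : Measure (SpinConfig (Site d))) [IsProbabilityMeasure μ]
    (hTI : IsTranslationInvariantMeasure μ) (hG : ∀ x y, 0 ≤ ∫ σ, spinAt x σ * spinAt y σ ∂μ)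
    {f : EuclideanSpace ℝ (Fin d) → ℝ} (hf : Continuous f) {r : ℝ} (hr : 1 ≤ r)
    (hfr : ∀ x, f x ≠ 0 → ∀ i, |x i| ≤ r) {L : ℝ} (hL : 1 ≤ L) :
    ∫ σ, normalizedField μ L f σ ^ 2 ∂μ ≤
      (⨆ x, |f x|) ^ 2 * ((((2 * (⌈r⌉₊ + 1) + 1) ^ d : ℕ) : ℝ) ^ 2) := by
  have hL0 : 0 < L := one_pos.trans_le hL
  have hr0 : 0 ≤ r := zero_le_one.trans hr
  set Bf := latticeBox d (r * L) with hBf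
  set a : Site d → ℝ := fun x => f (L⁻¹ • siteVec x) with ha
  have hS1 : 1 ≤ blockSpinVariance μ L := one_le_blockSpinVariance μ hG hL0.le
  have hS0 : 0 < blockSpinVariance μ L := one_pos.trans_le hS1
  -- `|a x| ≤ ‖f‖_∞ 1_{Bf}(x)` on `Bf`
  have hbdd : BddAbove (Set.range fun x => |f x|) :=
    (hf.abs).bddAbove_range_of_hasCompactSupport ((hasCompactSupport_of_cube hfr).comp_left abs_zero)
  have hab : ∀ x ∈ Bf, |a x| ≤ (⨆ y, |f y|) * (if x ∈ Bf then (1 : ℝ) else 0) := fun x hx => by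
    rw [if_pos hx, mul_one]
    exact le_ciSup hbdd _
  have hmono := sqMoment_mono μ hab hG
  rw [sqMoment_const_mul, ← blockSpinVariance_eq_sqMoment μ (subset_refl _)] at hmono
  -- doubling: `Σ_{rL} ≤ N² Σ_L`
  have hk : ⌊r * L⌋₊ + ⌊L⌋₊ ≤ (⌈r⌉₊ + 1) * (2 * ⌊L⌋₊ + 1) :=
    floor_add_floor_le_of_le_mul (by positivity) hr0 le_rfl
  have hdoub := integral_sq_sum_box_le μ hTI hG hk
  rw [← latticeBox_eq_box (by positivity : 0 ≤ r * L), ← latticeBox_eq_box hL0.le] at hdoub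
  change blockSpinVariance μ (r * L) ≤ _ * blockSpinVariance μ L at hdoub
  have hsup0 : 0 ≤ (⨆ y, |f y|) ^ 2 := sq_nonneg _
  rw [integral_normalizedField_sq_eq μ hL0 hfr hS0.le]
  calc (blockSpinVariance μ L)⁻¹ * sqMoment μ Bf a
      ≤ (blockSpinVariance μ L)⁻¹ * ((⨆ y, |f y|) ^ 2 * blockSpinVariance μ (r * L)) :=
        mul_le_mul_of_nonneg_left hmono (inv_nonneg.mpr hS0.le)
    _ ≤ (blockSpinVariance μ L)⁻¹ * ((⨆ y, |f y|) ^ 2 *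
          ((((2 * (⌈r⌉₊ + 1) + 1) ^ d : ℕ) : ℝ) ^ 2 * blockSpinVariance μ L)) := by gcongr
    _ = (⨆ x, |f x|) ^ 2 * ((((2 * (⌈r⌉₊ + 1) + 1) ^ d : ℕ) : ℝ) ^ 2) := by
        field_simp

/-- **Lower variance bound for one state** (Aizenman–Duminil-Copin 2021, p. 6,
`⟨T_{f,L}²⟩_β ≥ c_f > 0` for `f ≥ 0`, `f ≢ 0`, `L ≫ 1`): for a translation-invariant
probability measure with non-negative two-point function, if `f ≥ 0` vanishes outside
`[-r,r]^d` and `f ≥ η > 0` on the sup-norm ball of radius `δ₀ ≤ 1` around `x₀`, then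
`⟨T_{f,L}²⟩ ≥ η² (2(⌈2/δ₀⌉+1)+1)^{-2d}` for `L ≥ 1/δ₀ + 1`. [cite: AizenmanDuminilCopinAnnals2021, arXiv:1912.07973 p. 6 (display after Prop. 1.4)] -/
theorem le_integral_normalizedField_sq (μ : Measure (SpinConfig (Site d))) [IsProbabilityMeasure μ]
    (hTI : IsTranslationInvariantMeasure μ) (hG : ∀ x y, 0 ≤ ∫ σ, spinAt x σ * spinAt y σ ∂μ)
    {f : EuclideanSpace ℝ (Fin d) → ℝ} (hf0 : ∀ x, 0 ≤ f x) {r : ℝ} (hr : 1 ≤ r)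
    (hfr : ∀ x, f x ≠ 0 → ∀ i, |x i| ≤ r) {x₀ : EuclideanSpace ℝ (Fin d)} {η δ₀ : ℝ}
    (hη : 0 < η) (hδ₀ : 0 < δ₀) (hδ₁ : δ₀ ≤ 1)
    (hcont : ∀ y : EuclideanSpace ℝ (Fin d), (∀ i, |y i - x₀ i| < δ₀) → η ≤ f y)
    {L : ℝ} (hL : 1 / δ₀ + 1 ≤ L) :
    η ^ 2 / ((((2 * (⌈2 / δ₀⌉₊ + 1) + 1) ^ d : ℕ) : ℝ) ^ 2) ≤
      ∫ σ, normalizedField μ L f σ ^ 2 ∂μ := by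
  have hδinv : 0 < 1 / δ₀ := by positivity
  have hL1 : 1 ≤ L := by linarith
  have hL0 : 0 < L := one_pos.trans_le hL1
  have hLδ : 1 < L * δ₀ := by
    have : 1 / δ₀ < L := by linarith
    rwa [div_lt_iff₀ hδ₀] at this
  have hr0 : 0 ≤ r := zero_le_one.trans hr
  -- `x₀` lies in the cube (since `f x₀ ≥ η > 0`)
  have hx₀ : ∀ i, |x₀ i| ≤ r := hfr x₀ (by
    have := hcont x₀ (fun i => by simp [hδ₀])
    exact (hη.trans_le this).ne')
  set ε : ℝ := δ₀ / 2 with hε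
  have hε0 : 0 < ε := by positivity
  have hε1 : ε ≤ 1 / 2 := by rw [hε]; linarith
  -- the small box and its translate near `L x₀`
  set m : ℕ := ⌊ε * L⌋₊ with hm
  set v : Site d := fun i => round (L * x₀ i) with hv
  set V : Finset (Site d) := (box d m).image (· + v) with hV
  set Bf := latticeBox d (r * L) with hBf
  set Bf' := latticeBox d ((r + 2) * L) with hBf'
  set a : Site d → ℝ := fun x => f (L⁻¹ • siteVec x) with ha
  have hmL : (m : ℝ) ≤ ε * L := Nat.floor_le (by positivity)
  have hvround : ∀ i, |L * x₀ i - (v i : ℝ)| ≤ 1 / 2 := fun i => abs_sub_round _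
  -- (i) `V ⊆ Bf'`
  have hVsub : V ⊆ Bf' := by
    intro z hz
    obtain ⟨y, hy, rfl⟩ := Finset.mem_image.mp hz
    rw [hBf', mem_latticeBox]
    intro i
    have hyi := (mem_box.mp hy) i
    have hyabs : |((y i : ℤ) : ℝ)| ≤ m := by
      rw [← Int.cast_abs]
      exact_mod_cast abs_le.mpr ⟨hyi.1, hyi.2⟩
    have hvi : |(v i : ℝ)| ≤ L * r + 1 / 2 := by
      have h1 : |(v i : ℝ)| ≤ |L * x₀ i| + 1 / 2 := by
        have := hvround i
        rw [abs_sub_comm] at this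
        calc |(v i : ℝ)| = |(v i - L * x₀ i) + L * x₀ i| := by ring_nf
          _ ≤ |(v i : ℝ) - L * x₀ i| + |L * x₀ i| := abs_add_le _ _
          _ ≤ 1 / 2 + |L * x₀ i| := by linarith
          _ = |L * x₀ i| + 1 / 2 := by ring
      have h2 : |L * x₀ i| ≤ L * r := by
        rw [abs_mul, abs_of_pos hL0]
        exact mul_le_mul_of_nonneg_left (hx₀ i) hL0.le
      linarith
    simp only [Pi.add_apply, Int.cast_add]
    calc |((y i : ℤ) : ℝ) + (v i : ℝ)| ≤ |((y i : ℤ) : ℝ)| + |(v i : ℝ)| := abs_add_le _ _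
      _ ≤ m + (L * r + 1 / 2) := add_le_add hyabs hvi
      _ ≤ ε * L + (L * r + 1 / 2) := by linarith
      _ ≤ (r + 2) * L := by nlinarith
  -- (ii) on `V`, `a ≥ η`
  have haV : ∀ z ∈ V, η ≤ a z := by
    intro z hz
    obtain ⟨y, hy, rfl⟩ := Finset.mem_image.mp hz
    apply hcont
    intro i
    have hyi := (mem_box.mp hy) i
    have hyabs : |((y i : ℤ) : ℝ)| ≤ m := by
      rw [← Int.cast_abs]
      exact_mod_cast abs_le.mpr ⟨hyi.1, hyi.2⟩
    have hcoord : (L⁻¹ • siteVec (y + v)) i = L⁻¹ * ((y i : ℝ) + (v i : ℝ)) := by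
      simp [siteVec]
    rw [hcoord]
    have hkey : |((y i : ℝ) + (v i : ℝ)) - L * x₀ i| ≤ ε * L + 1 / 2 := by
      calc |((y i : ℝ) + (v i : ℝ)) - L * x₀ i| = |(y i : ℝ) + ((v i : ℝ) - L * x₀ i)| := by ring_nf
        _ ≤ |((y i : ℤ) : ℝ)| + |(v i : ℝ) - L * x₀ i| := abs_add_le _ _
        _ ≤ m + 1 / 2 := by
            have := hvround i
            rw [abs_sub_comm] at this
            exact add_le_add hyabs this
        _ ≤ ε * L + 1 / 2 := by linarith
    have hdiv : L⁻¹ * ((y i : ℝ) + (v i : ℝ)) - x₀ i = L⁻¹ * (((y i : ℝ) + (v i : ℝ)) - L * x₀ i) := by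
      field_simp
    rw [hdiv, abs_mul, abs_inv, abs_of_pos hL0]
    calc L⁻¹ * |((y i : ℝ) + (v i : ℝ)) - L * x₀ i| ≤ L⁻¹ * (ε * L + 1 / 2) :=
          mul_le_mul_of_nonneg_left hkey (inv_nonneg.mpr hL0.le)
      _ = ε + 1 / (2 * L) := by field_simp
      _ < δ₀ := by
          rw [hε]
          have : 1 / (2 * L) < δ₀ / 2 := by
            rw [div_lt_div_iff₀ (by positivity) (by positivity)]
            nlinarith
          linarith
  -- (iii) Griffiths monotonicity: `η 1_V ≤ a` on `Bf'`
  have hab : ∀ x ∈ Bf', |η * (if x ∈ V then (1 : ℝ) else 0)| ≤ a x := fun x _ => by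
    split_ifs with hx
    · rw [mul_one, abs_of_pos hη]
      exact haV x hx
    · rw [mul_zero, abs_zero]
      exact hf0 _
  have hmono := sqMoment_mono μ hab hG
  -- (iv) the dominated side is `η² Σ^{(m)}`
  have hsmall : sqMoment μ Bf' (fun x => η * (if x ∈ V then (1 : ℝ) else 0)) =
      η ^ 2 * ∫ σ, (∑ x ∈ box d m, spinAt x σ) ^ 2 ∂μ := by
    rw [sqMoment_const_mul]
    congr 1
    unfold sqMoment
    simp_rw [spinSum_indicator hVsub]
    exact integral_sq_sum_spinAt_translate μ hTI (box d m) v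
  rw [hsmall] at hmono
  -- (v) `a` vanishes on `Bf' \ Bf`
  have hBsub : Bf ⊆ Bf' := by
    intro x hx
    rw [hBf, mem_latticeBox] at hx
    rw [hBf', mem_latticeBox]
    intro i
    exact (hx i).trans (by nlinarith)
  have hazero : ∀ x ∈ Bf', x ∉ Bf → a x = 0 := by
    intro x _ hx
    by_contra h
    apply hx
    rw [hBf, mem_latticeBox]
    intro i
    have := hfr _ h i
    rw [PiLp.smul_apply, siteVec_apply, smul_eq_mul, abs_mul, abs_inv, abs_of_pos hL0,
      inv_mul_le_iff₀ hL0] at this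
    linarith
  -- (vi) doubling: `Σ_L ≤ N'² Σ^{(m)}`
  have hk : ⌊L⌋₊ + ⌊ε * L⌋₊ ≤ (⌈2 / δ₀⌉₊ + 1) * (2 * ⌊ε * L⌋₊ + 1) := by
    have h := floor_add_floor_le_of_le_mul (M := L) (t := 2 / δ₀) (L' := ε * L) hL0.le
      (by positivity) (by rw [hε]; field_simp; rfl)  -- L ≤ (2/δ₀)(δ₀/2 L)
    exact h
  have hdoub := integral_sq_sum_box_le μ hTI hG hk
  rw [← latticeBox_eq_box hL0.le] at hdoub
  change blockSpinVariance μ L ≤ _ * ∫ σ, (∑ x ∈ box d m, spinAt x σ) ^ 2 ∂μ at hdoub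
  have hS1 : 1 ≤ blockSpinVariance μ L := one_le_blockSpinVariance μ hG hL0.le
  have hS0 : 0 < blockSpinVariance μ L := one_pos.trans_le hS1
  set N : ℝ := (((2 * (⌈2 / δ₀⌉₊ + 1) + 1) ^ d : ℕ) : ℝ) with hN
  have hN0 : 0 < N := by rw [hN]; positivity
  -- conclusion
  rw [integral_normalizedField_sq_eq μ hL0 hfr hS0.le, sqMoment_subset μ hBsub hazero]
  have hN2 : 0 < N ^ 2 := by positivity
  calc η ^ 2 / N ^ 2 = η ^ 2 * (1 / N ^ 2) := by ring
    _ ≤ η ^ 2 * ((∫ σ, (∑ x ∈ box d m, spinAt x σ) ^ 2 ∂μ) / blockSpinVariance μ L) := by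
        refine mul_le_mul_of_nonneg_left ?_ (sq_nonneg η)
        rw [div_le_div_iff₀ hN2 hS0, one_mul]
        linarith [hdoub]
    _ = (blockSpinVariance μ L)⁻¹ * (η ^ 2 * ∫ σ, (∑ x ∈ box d m, spinAt x σ) ^ 2 ∂μ) := by
        ring
    _ ≤ (blockSpinVariance μ L)⁻¹ * sqMoment μ Bf' a :=
        mul_le_mul_of_nonneg_left hmono (inv_nonneg.mpr hS0.le)

end VarianceBounds

section VarianceAssembly

/-- **Structure of the states `μ ∈ 𝒢(β, 0)`, `β ≤ β_c`, from the named facts**: uniqueness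
(`hasUniqueGibbsMeasure_of_lt_criticalBeta`, `hasUniqueGibbsMeasure_criticalBeta`) and the free
state (`exists_freeMeasure`) make every such `μ` the translation-invariant free state, whose
two-point function is non-negative by Griffiths' first inequality (`freeCorr_nonneg`, proved in
`GKSInequalities`) (Friedli–Velenik 2017, Thm. 3.28, Exercise 3.16, Thm. 3.20). [cite: FriedliVelenik2017, Thm. 3.28 and Exercise 3.16] -/
theorem isingGibbsMeasure_structure_of_facts
    (hU₁ : ∀ {d : ℕ} {β : ℝ}, hasUniqueGibbsMeasure_of_lt_criticalBeta (d := d) (β := β))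
    (hU₂ : ∀ {d : ℕ}, hasUniqueGibbsMeasure_criticalBeta (d := d))
    (hF : ∀ (d : ℕ) {β : ℝ}, exists_freeMeasure d (β := β) 0)
    (hd : 3 ≤ d) {β : ℝ} (hβ : 0 ≤ β) (hβc : β ≤ criticalBeta d)
    {μ : Measure (SpinConfig (Site d))} (hμ : μ ∈ isingGibbsMeasures d β 0) :
    IsProbabilityMeasure μ ∧ IsTranslationInvariantMeasure μ ∧
      ∀ x y, 0 ≤ ∫ σ, spinAt x σ * spinAt y σ ∂μ := by
  classical
  obtain ⟨μf, hμf, hTI, hcorr⟩ := hF d hβ le_rfl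
  have huniq : HasUniqueGibbsMeasure (isingSpecification (zdGraph d) β 0) := by
    rcases hβc.lt_or_eq with hlt | heq
    · exact hU₁ (by omega) hβ hlt
    · rw [heq]
      exact hU₂ hd
  have hμeq : μ = μf := huniq.1 hμ hμf
  subst hμeq
  haveI : IsProbabilityMeasure μ := hμ.1
  refine ⟨hμ.1, hTI, fun x y => ?_⟩
  by_cases hxy : x = y
  · subst hxy
    simp
  · have hpair : ∀ σ, spinAt x σ * spinAt y σ = spinProduct {x, y} σ := fun σ => by
      rw [spinProduct, Finset.prod_pair hxy]
    simp_rw [hpair]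
    change 0 ≤ spinCorr μ {x, y}
    rw [hcorr]
    exact freeCorr_nonneg hβ le_rfl _

/-- **The variance bounds from the named facts on `𝒢(β, 0)`.** The two-sided bound
`0 < c_f ≤ ⟨T_{f,L}²⟩_β ≤ C_f` uniformly in `β ≤ β_c` (Aizenman–Duminil-Copin 2021, p. 6;
Panis 2023, fn. 3), i.e. `normalizedField_variance_bounds` of `HighDimTriviality`, follows from
uniqueness of the Gibbs measure up to `β_c` and the existence of the free state (named facts),
through translation invariance, Griffiths' first inequality and the covering argument of this
file (`integral_normalizedField_sq_le`, `le_integral_normalizedField_sq`). [cite: AizenmanDuminilCopinAnnals2021, arXiv:1912.07973 p. 6 (display after Prop. 1.4)] -/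
theorem normalizedField_variance_bounds_of_facts
    (hU₁ : ∀ {d : ℕ} {β : ℝ}, hasUniqueGibbsMeasure_of_lt_criticalBeta (d := d) (β := β))
    (hU₂ : ∀ {d : ℕ}, hasUniqueGibbsMeasure_criticalBeta (d := d))
    (hF : ∀ (d : ℕ) {β : ℝ}, exists_freeMeasure d (β := β) 0) :
    normalizedField_variance_bounds := by
  intro d hd f hf hfs
  have hd3 : 3 ≤ d := by omega
  obtain ⟨r, hr1, hfr⟩ := exists_cube_of_hasCompactSupport f hfs
  refine ⟨⟨(⨆ x, |f x|) ^ 2 * ((((2 * (⌈r⌉₊ + 1) + 1) ^ d : ℕ) : ℝ) ^ 2),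
    fun β L hβ hβc hL μ hμ => ?_⟩, fun hf0 hne => ?_⟩
  · obtain ⟨hP, hTI, hG⟩ := isingGibbsMeasure_structure_of_facts hU₁ hU₂ hF hd3 hβ hβc hμ
    haveI := hP
    exact integral_normalizedField_sq_le μ hTI hG hf hr1 hfr hL
  · -- a point where `f > 0`, and a sup-norm ball around it on which `f ≥ f(x₀)/2`
    obtain ⟨x₀, hx₀⟩ : ∃ x₀, f x₀ ≠ 0 := Function.ne_iff.mp hne
    have hpos : 0 < f x₀ := lt_of_le_of_ne (hf0 x₀) (Ne.symm hx₀)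
    set e := EuclideanSpace.equiv (Fin d) ℝ with he
    have hg : Continuous fun y : Fin d → ℝ => f (e.symm y) := hf.comp e.symm.continuous
    obtain ⟨δ, hδ, hδf⟩ := Metric.continuousAt_iff.mp hg.continuousAt (f x₀ / 2) (by positivity)
    set δ₀ : ℝ := min δ 1 with hδ₀
    have hδ₀pos : 0 < δ₀ := lt_min hδ one_pos
    have hδ₀1 : δ₀ ≤ 1 := min_le_right _ _
    have hcont : ∀ y : EuclideanSpace ℝ (Fin d), (∀ i, |y i - x₀ i| < δ₀) → f x₀ / 2 ≤ f y := by
      intro y hy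
      have hdist : dist (e y) (e x₀) < δ := by
        rw [dist_pi_lt_iff hδ]
        intro i
        rw [Real.dist_eq]
        have := hy i
        simp only [he] at this ⊢
        simpa using this.trans_le (min_le_left _ _)
      have h := hδf (x := e y) (by simpa using hdist)
      rw [Real.dist_eq] at h
      have h1 : f (e.symm (e y)) = f y := by simp
      have h2 : f (e.symm (e x₀)) = f x₀ := by simp
      rw [h1, h2] at h
      have := (abs_lt.mp h).1
      linarith
    refine ⟨(f x₀ / 2) ^ 2 / ((((2 * (⌈2 / δ₀⌉₊ + 1) + 1) ^ d : ℕ) : ℝ) ^ 2), 1 / δ₀ + 1,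
      by positivity, fun β L hβ hβc hL μ hμ => ?_⟩
    obtain ⟨hP, hTI, hG⟩ := isingGibbsMeasure_structure_of_facts hU₁ hU₂ hF hd3 hβ hβc hμ
    haveI := hP
    exact le_integral_normalizedField_sq μ hTI hG hf0 hr1 hfr (by positivity) hδ₀pos hδ₀1
      hcont hL

end VarianceAssembly

/-! ### Part H. crit-ising.S13 (printed regime) from the moment-level and structural facts -/

universe u in
/-- **crit-ising.S13 in the printed regime from the remaining named facts.** Assembling Parts
D–G: the Gaussianity of scaling limits
`isGaussianProcess_of_tendstoInDistribution_smearedSpin_printRegime` follows from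
(i) the smeared Aizenman inequality `aizenman_evenMoment_deviation_le` and Gaussian domination
`newman_evenMoment_le` (random-current input), (ii) the two bounds on `∑ |U₄|`:
`aizenmanDuminilCopin_ursellFourSum_le` (`d = 4`, ADC Thm 1.3 + §6.3) and
`panis_ursellFourSum_le` (`d ≥ 5`, Panis §5), and (iii) the structure of `𝒢(β, 0)` up to `β_c`:
uniqueness (`hasUniqueGibbsMeasure_of_lt_criticalBeta`, `hasUniqueGibbsMeasure_criticalBeta`),
the free state (`exists_freeMeasure`) and the finite-volume flip symmetry
(`isingCorr_free_of_odd_card`, discharged in the tree by `isingCorr_free_of_odd_card_holds` of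
`PlusFreeComparison`, to be supplied by the user: seven of the eight inputs are named facts
without proof). [cite: AizenmanDuminilCopinAnnals2021, arXiv:1912.07973 Prop. 1.4, Thm 1.3 and §6.3] [cite: Panis2023Triviality, Thm. 5.5] -/
theorem isGaussianProcess_of_tendstoInDistribution_smearedSpin_printRegime_of_facts
    (hM₁ : aizenman_evenMoment_deviation_le) (hM₂ : newman_evenMoment_le)
    (hS₄ : aizenmanDuminilCopin_ursellFourSum_le) (hS₅ : panis_ursellFourSum_le)
    (hU₁ : ∀ {d : ℕ} {β : ℝ}, hasUniqueGibbsMeasure_of_lt_criticalBeta (d := d) (β := β))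
    (hU₂ : ∀ {d : ℕ}, hasUniqueGibbsMeasure_criticalBeta (d := d))
    (hF : ∀ (d : ℕ) {β : ℝ}, exists_freeMeasure d (β := β) 0)
    (hodd : ∀ d : ℕ, isingCorr_free_of_odd_card (zdGraph d)) :
    isGaussianProcess_of_tendstoInDistribution_smearedSpin_printRegime.{u} :=
  have hM₄ : oddSpinCorrelation_eq_zero := oddSpinCorrelation_eq_zero_of_facts hU₁ hU₂ hF hodd
  isGaussianProcess_of_tendstoInDistribution_smearedSpin_printRegime_of_bounds'
    (aizenmanDuminilCopin_mgf_normalizedField_bound_abs_of_moments hM₁ hM₂ hS₄ hM₄)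
    (normalizedField_variance_bounds_of_facts hU₁ hU₂ hF)
    (panis_mgf_normalizedField_bound_of_moments hM₁ hM₂ hS₅ hM₄)

end Literature.Probability.LatticeModels
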